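import Mathlib
import Literature.MathematicalPhysics.QuantumFieldTheory.Balaban1983to89.B12Decay510R1
import Literature.MathematicalPhysics.QuantumFieldTheory.Balaban1983to89.B12Decay510FromB11

/-!
# `Balaban1983to89.B12Ward414` — T. Bałaban, *Renormalization group approach to lattice gauge field theories.
I. Generation of effective actions in a small field approximation and a coupling constant renormalization in four
dimensions*, Commun. Math. Phys. **109**, 249–301 (1987) [Balaban1987RG1], pp. 282–284 [PDF 34–36], (4.7)–(4.14):
**the first-order Ward–Takahashi identity and (4.14) (δ/δB)𝐄(1) = 0, kernel-checked in abstract form, and the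
(5.10) chain with (4.14) discharged to gauge invariance + semisimplicity**.

CITATION HEADER (lean-in-tree rule 2026-08-18).  Satellite of `…Balaban1983to89.B12Decay510R1` (unit
`b2b-balaban-b03-g4`: (5.10) from the FULL n = 2 form of (4.3), the r = 1 member dropped under the 𝐇-form hypothesis
`h414 : fderiv ℂ E_X 0 = 0` of (4.14); the algebra (4.13) ⇒ (4.14) `eq_zero_of_forall_lie_eq_zero`) and of
`…Balaban1983to89.B12Decay510FromB11` (same unit: the leaf `hh` discharged from [15] (190) + [3] (2.61) + three
dictionary hypotheses).  Unit `b2b-balaban-b03-g5` (paper sub-cell B03 gen 5, cell `pub-balaban`), answering cell GAPS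
G-b03g4-1 / C-b03g4-2 (A) (*"(4.14) … recorded as the hypothesis `h414`; its derivation (4.8)–(4.14) uses only gauge
invariance, analyticity and semisimplicity"*) and BETA-SPEC §6 row (U) (the residual-leaf column of the (5.10) ⇒ ∣β∣ ≤ β′
chain).  Quotations below were re-read on the 300-dpi renders `HOME/b2b-balaban-ref1/pages/1987-cmp109-rg-I-small-field/
1987-cmp109-rg-I-small-field-p034-x2.png` (p. 282), `…-p035-x2.png` (p. 283), `…-p036-x2.png` (p. 284) (PDF page = journal
page − 248); nothing is quoted from memory or OCR.

RELATION TO `…Balaban1983to89.Beta.WardIdentity` (β sub-cell row an2 / adv2-g10): that module proves LEMMA W, the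
SECOND-order identity D²f(0)(v, X 0) = 0 for an invariant f ASSUMING criticality `Df(0) = 0` (its hypothesis `hcrit`,
*"criticality from the centre argument"* left to the analysis), over ℝ.  The present module is the complementary
FIRST-order statement: criticality itself, (4.14), DERIVED from invariance under a linear action whose generators detect
vectors (the centre argument of p. 284), over any normed field (ℂ for the analytic 𝐄 of (4.7)).  Nothing of
`Beta.WardIdentity` is restated or modified.

WHAT THE PAPER PRINTS (and nothing else is attributed to it):
* p. 282 [34], verbatim: *"The tools to investigate the sum in (4.6) are provided by a set of Ward-Takahashi identities.
  They express gauge invariance of a considered function. Take a function 𝐄(V) defined and analytic on a domain of small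
  gauge field configurations V on a unit lattice, and assume that it is gauge invariant, i.e.,
  𝐄(V^v) = 𝐄(V), V^v(b) = v(b₋)V(b)v⁻¹(b₊). (4.7)"*
* p. 283 [35], verbatim: *"We assume the gauge invariance with respect to Gᶜ-valued gauge transformations, but it is
  implied by the invariance with respect to G-valued transformations, and by the analyticity of the function, as it was
  noticed already. For a small gauge field V = exp iB, and a small gauge transformation v = exp iλ, B and λ small, we
  have"* (4.8), whose last printed line reads *"= B(b) + i[λ(b₋), B(b)] − g⁻¹(iad_{B(b)})(δλ)(b) + …, where the dots
  denote terms of higher order in λ, and g⁻¹(z) = (−z)/(e^{−z} − 1) = 1 + ½z + k₂z² + …."*; then *"Now differentiate the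
  equality (4.7) with respect to λ, at λ = 0. This gives the identity ⟨(δ/δB)𝐄(exp iB), i[λ(b₋), B(b)] −
  g⁻¹(iad_{B(b)})(∂λ)(b)⟩ = 0 (4.9) holding for all 𝐠ᶜ-valued functions λ, and small, 𝐠ᶜ-valued configurations B. It
  is the fundamental identity expressing the gauge invariance of the function 𝐄. … From this we derive a whole sequence
  of identities by differentiations with respect to B."* and (4.10): *"⟨(δ²/δB²)𝐄(exp iB), iad_{λ₋}B − g⁻¹(iad_B)∂λ, B₁⟩
  + ⟨(δ/δB)𝐄(exp iB), iad_{λ₋}B₁ − ½iad_{B₁}∂λ − k₂{iad_{B₁}, iad_B}∂λ − …⟩ = 0, (4.10)"*.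
* p. 284 [36], verbatim: *"We are interested in the above identities at B = 0, because such expressions only appear in
  the sum (4.6). This simplifies them in an essential way. Consider at first (4.10) at B = 0
  ⟨(δ²/δB²)𝐄(1), −∂λ, B₁⟩ + ⟨(δ/δB)𝐄(1), iad_λ₋B₁ − ½iad_{B₁}∂λ⟩ = 0. (4.13) For constant λ we get
  ⟨(δ/δB)𝐄(1), iad_λB₁⟩ = 0, and since the configuration B₁ is arbitrary, we get [λ, (δ/δB)𝐄(1)] = 0 for all λ ∈ 𝐠ᶜ.
  The group G is semisimple, hence this is possible only for the element 0 in the algebra 𝐠ᶜ. Thus we have the first,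
  very important consequence of the gauge invariance (δ/δB)𝐄(1) = 0. (4.14) This equality simplifies the identities, and
  also the sum (4.6), we can drop the term with n = 1."*

* p. 284 [36], verbatim (continuing): *"This equality simplifies the identities, and also the sum (4.6), we can drop the term
  with n = 1. We obtain the following set of Ward-Takahashi identities ⟨(δ²/δB²)𝐄(1), B₁, ∂λ⟩ = 0,
  ⟨(δ³/δB³)𝐄(1), B₁, B₂, ∂λ⟩ − ⟨(δ²/δB²)𝐄(1), B₁, i[λ₋, B₂] − ½i[B₂, ∂λ]⟩ − (B₁↔B₂) = 0, …"* [third line: the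
  fourth-order identity] *"(4.15) for an arbitrary gauge function λ, and arbitrary gauge fields B₁, B₂, B₃."*, with (top of
  p. 284) *"where the symbol (B₁↔B₂) denotes an expression obtained from the preceding one by the exchange of B₁ with B₂"*.

WHAT THIS MODULE PROVES (kernel-checked, `[folklore]` calculus / linear algebra; NOTHING about Bałaban's actual
functionals is asserted — invariance, analyticity, the generator family and its detecting property are HYPOTHESES of the
printed shape):
1. `fderiv_apply_eq_zero_of_const_along` (+ `…_real`): (4.7) ⇒ (4.9) — a function differentiable at B and constant
   along a curve through B with velocity v has Df(B)v = 0 (the real-parameter version for a ℂ-differentiable f is the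
   printed remark *"implied by the invariance with respect to G-valued transformations, and by the analyticity"*).
2. `ward_first_order`: (4.9) ⇒ (4.10)∣_{B=0} = (4.13) — f C² at 0, generator field X differentiable at 0,
   Df(B)[X(B)] = 0 for B near 0 ⟹ D²f(0)(v, X 0) + Df(0)(DX(0)v) = 0 for every v (differentiate the identically
   vanishing B ↦ Df(B)[X(B)] at 0 by the product rule).  For the gauge action B ↦ (1/i)log((exp iB)^{exp iλ}) the
   generator is X_λ(B) = i[λ₋, B] − g⁻¹(iad_B)∂λ ((4.8)–(4.9)), X_λ(0) = −∂λ, DX_λ(0)B₁ = iad_{λ₋}B₁ − ½iad_{B₁}∂λ: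
   the two printed terms of (4.13).
3. `fderiv_apply_generator_eq_zero` / `fderiv_comp_generator_eq_zero`: *"For constant λ"* — X_λ(0) = 0 (∂λ = 0), the
   generator is the LINEAR map L_λ = iad_λ, and (4.13) reads Df(0) ∘ L_λ = 0, i.e. *"⟨(δ/δB)𝐄(1), iad_λB₁⟩ = 0"*.
4. `fderiv_eq_zero_of_generators` / `fderiv_eq_zero_of_analytic_invariant`: (4.13) ⇒ (4.14) — if the ranges of the
   linear generators L_λ span a dense subspace (the DETECTING property), then Df(0) = 0.
5. The printed detecting argument in the Lie model (`adConst`, `pairing`): for a 𝐠-valued configuration F on finitely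
   many bonds, an ad-invariant bilinear form Φ without null vectors and 𝐠 semisimple,
   Σ_x Φ(F(x), [λ, B₁(x)]) = 0 for all λ, B₁ ⟹ F = 0 (`eq_zero_of_pairing_adConst_eq_zero`: *"since the configuration B₁
   is arbitrary, we get [λ, (δ/δB)𝐄(1)] = 0 for all λ … G is semisimple, hence this is possible only for the element 0"*,
   the centre step being `B12Decay510R1.eq_zero_of_forall_lie_eq_zero`); the Killing-form instance
   `eq_zero_of_killing_adConst_eq_zero` (Mathlib `LieAlgebra.IsKilling`); and, over a field with Φ nondegenerate,
   the detecting property itself: `span_range_adConst_eq_top` — the ranges of the ad_λ SPAN the configuration space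
   (so the hypothesis `hspan` of item 4 holds in the finite-dimensional Lie model, with any norm).
6. CAPSTONE for BETA-SPEC §6 row (U) (`decay510_window_414_190`, `decay510_window_ward_190`,
   `decay510_of_leaves_ward_190`): the (5.10) conclusion `B12Sec2to5.Decay510` from the census of residual printed
   leaves ONLY — the full n = 2 form of (4.3) (`hrepr43`), gauge invariance in the infinitesimal constant-λ form (4.9)
   (`h49`) with detecting generators (`hspan`) [or directly the 𝐇-form (4.14) `h414`], analyticity (4.4) (`han`) with
   (1.18) (`h118`), [15] (190) (`h190`), [3] (2.61) (`hrow`), the three dictionary hypotheses of `B12Decay510FromB11`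
   (`hN`, `hm`, `hD`), the window geometry (`hκ`) and the limit (5.1) (`hlim`) — with NO hypothesis `h414`/`hh`/`hh2`:
   `B12Decay510R1.repr435_of_repr43` + `B12Decay510FromB11.decay510_window_190` /
   `decay510_of_analytic_leaves_190`.  In particular NO n(p) ≥ 2 input of [15] Sect. G enters (cell GAPS C-b03g4-2 (A)).

7. (v1.1) (4.15), first two lines, abstract: `hessian_apply_generator_eq_zero` — (4.13) + (4.14) ⟹ D²f(0)(v, X(0)) = 0
   (*"⟨(δ²/δB²)𝐄(1), B₁, ∂λ⟩ = 0"*: the Hessian at the unit annihilates the pure gauge directions X_λ(0) = −∂λ; this is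
   `Beta.WardIdentity.sndFDeriv_apply_generator_eq_zero` (Lemma W, an2) for 𝕜 = ℝ = F — here over any 𝕜 and F, and in
   `hessian_apply_generator_eq_zero_of_generators` with the criticality hypothesis DISCHARGED by item 4);
   `ward_second_order` — (4.11)∣_{B=0} [(4.11) = the third-order member of the printed sequence (4.10)–(4.12), p. 283;
   its display is quoted at `ward_second_order_eventually`, item 11]: f C³, X C² at 0, Df(B)[X(B)] = 0 near 0 ⟹ D³f(0)(v, w, X 0) + D²f(0)(v, DX(0)w)
   + D²f(0)(w, DX(0)v) + Df(0)(D²X(0)(v, w)) = 0, and with (4.14) (`ward_second_order_of_fderiv_eq_zero`) the printed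
   second line of (4.15) (X_λ(0) = −∂λ, DX_λ(0)B₂ = i[λ₋, B₂] − ½i[B₂, ∂λ], the exchange term = (B₁↔B₂)).
8. (v1.1) The detecting property TRANSPORTED to any configuration space: `span_range_eq_top_of_conj` (a linear
   equivalence conjugating two generator families transports span-of-ranges = ⊤), `span_range_adConst_eq_top_of_isKilling`,
   and `dense_span_range_of_conj_adConst` — for ANY normed 𝕜-space E that is 𝕜-linearly isomorphic (no topology asked of
   the isomorphism) to the 𝐠-valued configurations on finitely many bonds, by an isomorphism conjugating the generators
   L_λ to ad_λ, the hypothesis `hspan` of items 4 and 6 HOLDS.  For a finite window the configuration space IS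
   finite-dimensional, so nothing about Bałaban's (4.4)-norm remains to be assumed at this point.
9. (v1.1) `decay510_window_lie_190`: the capstone of item 6 with `hspan` replaced by the printed algebraic data —
   𝐠 finite-dimensional semisimple over ℂ with an ad-invariant nondegenerate bilinear form Φ, finitely many bonds per
   window, a ℂ-linear identification of the window's configuration space with (bonds → 𝐠) conjugating the constant
   gauge generators to ad_λ — and (4.9) for those generators.

10. (v1.2) Over a field of characteristic 0, SEMISIMPLICITY ALONE supplies the invariant nondegenerate form (the Killing
   form — Cartan's criterion, Mathlib `LieAlgebra.HasTrivialRadical.instIsKilling`; observed by the cross-read GAPS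
   C-adv2-26, R2): `span_range_adConst_eq_top_of_isSemisimple`, `dense_span_range_of_conj_adConst_of_isSemisimple`, and
   the capstone `decay510_window_semisimple_190` whose algebraic hypotheses are exactly *"The group G is semisimple"*
   (𝐠 finite-dimensional semisimple over ℂ), finitely many bonds per window and the conjugation of the generators to ad_λ.
11. (v1.3) The remaining printed identities of pp. 283–284 (p. 283: *"For our purpose it is enough to consider expressions
   with four derivatives at most"*): `ward_first_order_eventually` / `ward_second_order_eventually` — (4.10) / (4.11) FOR B
   NEAR 0 (not only at B = 0), abstractly: Df(B)[X(B)] = 0 near 0 ⟹ D²f(B)(w, X B) + Df(B)(DX(B)w) = 0 and its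
   B-derivative, for all B near 0; `ward_third_order` — (4.12)∣_{B=0}: f C⁴, X C³ at 0 ⟹ the eight-term fourth-order
   identity D⁴f(0)(u, v, w, X 0) + [three D³f terms] + [three D²f terms] + Df(0)(D³X(0)(u, v, w)) = 0; and with (4.14)
   (`ward_third_order_of_fderiv_eq_zero`) the printed THIRD line of (4.15).  With this ALL the displayed identities
   (4.9)–(4.15) of B12 §4 up to (4.15) have abstract kernel-checked counterparts (the dots *"…"* after (4.12) — higher
   orders the paper does not use — are not typed).

NOT PROVED / NOT CLAIMED: that 𝐄^{(j)}(X, ·) of (4.2) is analytic and gauge invariant (B12 (4.2)/(4.4), hypotheses);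
the expansion (4.8) itself — the generator X_λ(B) = i[λ₋, B] − g⁻¹(iad_B)∂λ of the gauge action and its Taylor
coefficients X_λ(0) = −∂λ, DX_λ(0) (p. 283: *"as in (32)–(41) [12]"*, a BCH computation) are QUOTED and enter items 2, 3,
7 only through the abstract generator field X (cross-read GAPS C-adv2-26, R1);
that Bałaban's constant gauge transformations act on the (4.2)-variables through ad_λ bond by bond (the conjugation
hypothesis `hconj` of items 8–9 — immediate for V = exp iB ↦ vVv⁻¹, but the (4.2) functionals carry further variables);
the identities of order > 4 indicated by *"…"* (not used by the paper); (190) itself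
(cell GAPS G-B11-G2, G-B11-G2a); the limit (5.1).  Value = kernel certificate of a printed derivation + census theorem,
NOT summit progress.

REVISION LOG.  v1 (p179659, commit ec3c9cc883f6): items 1–6.  v1.1 (this file): + items 7–9 ((4.15) lines 1–2 abstract;
transport of the detecting property; capstone with `hspan` discharged to semisimplicity data); the p. 284 (4.15) quotation
added (render p036 re-read as image); every v1 declaration unchanged.  v1.2 (p179966, commit e579e7e25845): + item 10 (semisimplicity
alone, via Mathlib's Cartan criterion — cross-read C-adv2-26 R2) and the (4.8) clause of NOT PROVED (C-adv2-26 R1);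
every v1.1 (p179901, commit 5522fb478146) declaration unchanged.  v1.3 (this file): + item 11 ((4.10)/(4.11) near the
unit, (4.12)∣_{B=0}, the third line of (4.15); renders p035/p036 = pp. 283/284 re-read as images); every v1.2 declaration
unchanged (statements and proofs; two docstring cross-references of item 7 / `ward_second_order` updated).
-/

namespace Literature.MathematicalPhysics.QuantumFieldTheory.Balaban1983to89.B12Ward414

open Literature.MathematicalPhysics.QuantumFieldTheory.Balaban1983to89
open Literature.MathematicalPhysics.QuantumFieldTheory.Balaban1983to89.B11SectG
open Literature.MathematicalPhysics.QuantumFieldTheory.Balaban1983to89.B12Decay510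
open Literature.MathematicalPhysics.QuantumFieldTheory.Balaban1983to89.B12Decay510R1
open Literature.MathematicalPhysics.QuantumFieldTheory.Balaban1983to89.B12Decay510FromB11
open Filter Topology Metric

/-! ## 1. (4.7) ⇒ (4.9) ⇒ (4.13): the first-order Ward–Takahashi identity -/

section Ward

variable {𝕜 : Type*} [NontriviallyNormedField 𝕜] {E F : Type*} [NormedAddCommGroup E] [NormedSpace 𝕜 E]
  [NormedAddCommGroup F] [NormedSpace 𝕜 F]

/-- **(4.7) ⇒ (4.9), abstract**: p. 283 *"Now differentiate the equality (4.7) with respect to λ, at λ = 0"* — if f is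
differentiable at B and constant (for small parameter) along a curve γ through B with velocity v, then Df(B)v = 0.  The
𝕜-parameter version (Gᶜ-valued transformations for 𝕜 = ℂ); cf. `Beta.WardIdentity.fderiv_apply_eq_zero_of_const_along`
(ℝ, scalar-valued). [cite: Balaban1987RG1, (4.7)-(4.9) pp.282-283] -/
theorem fderiv_apply_eq_zero_of_const_along {f : E → F} {B v : E} {γ : 𝕜 → E}
    (hγ0 : γ 0 = B) (hγ : HasDerivAt γ v 0) (hfd : DifferentiableAt 𝕜 f B)
    (hconst : ∀ᶠ t in 𝓝 (0 : 𝕜), f (γ t) = f B) : fderiv 𝕜 f B v = 0 := by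
  have hf' : HasFDerivAt f (fderiv 𝕜 f B) (γ 0) := by
    rw [hγ0]; exact hfd.hasFDerivAt
  have h1 : HasDerivAt (f ∘ γ) (fderiv 𝕜 f B v) 0 := hf'.comp_hasDerivAt 0 hγ
  have h2 : HasDerivAt (f ∘ γ) 0 0 := by
    have hc : (f ∘ γ) =ᶠ[𝓝 (0 : 𝕜)] fun _ => f B := hconst
    exact (hasDerivAt_const (0 : 𝕜) (f B)).congr_of_eventuallyEq hc
  exact h1.unique h2

/-- **(4.7) ⇒ (4.9) with a REAL parameter for a ℂ-differentiable function**: p. 283 *"We assume the gauge invariance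
with respect to Gᶜ-valued gauge transformations, but it is implied by the invariance with respect to G-valued
transformations, and by the analyticity of the function"* — invariance along a real one-parameter family (v = exp itλ,
λ ∈ 𝐠, t ∈ ℝ) already gives the vanishing of the COMPLEX derivative in the direction of the velocity.
[cite: Balaban1987RG1, p.283] -/
theorem fderiv_apply_eq_zero_of_const_along_real {E F : Type*} [NormedAddCommGroup E] [NormedSpace ℂ E]
    [NormedAddCommGroup F] [NormedSpace ℂ F] {f : E → F} {B v : E} {γ : ℝ → E}
    (hγ0 : γ 0 = B) (hγ : HasDerivAt γ v 0) (hfd : DifferentiableAt ℂ f B)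
    (hconst : ∀ᶠ t in 𝓝 (0 : ℝ), f (γ t) = f B) : fderiv ℂ f B v = 0 := by
  have h := fderiv_apply_eq_zero_of_const_along (𝕜 := ℝ) hγ0 hγ (hfd.restrictScalars ℝ) hconst
  rwa [(hfd.hasFDerivAt.restrictScalars ℝ).fderiv, ContinuousLinearMap.coe_restrictScalars'] at h

/-- **(4.9) ⇒ (4.10)∣_{B=0} = (4.13), abstract** (p. 283 *"From this we derive a whole sequence of identities by
differentiations with respect to B"*, p. 284 *"Consider at first (4.10) at B = 0 … (4.13)"*): if f is C² at 0, the
generator field X is differentiable at 0 and f is infinitesimally invariant along X near 0 (Df(B)[X(B)] = 0), then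
D²f(0)(v, X(0)) + Df(0)(DX(0)v) = 0 for every direction v = B₁ — the two terms of (4.13) (X_λ(0) = −∂λ,
DX_λ(0)B₁ = iad_{λ₋}B₁ − ½iad_{B₁}∂λ for the gauge generator of (4.8)–(4.9)).  Proof: differentiate the identically
vanishing B ↦ Df(B)[X(B)] at 0 (`fderiv_clm_apply`). [cite: Balaban1987RG1, (4.9)-(4.13) pp.283-284] -/
theorem ward_first_order {f : E → F} {X : E → E} (hf : ContDiffAt 𝕜 2 f 0) (hX : DifferentiableAt 𝕜 X 0)
    (hinv : ∀ᶠ B in 𝓝 (0 : E), fderiv 𝕜 f B (X B) = 0) (v : E) :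
    fderiv 𝕜 (fderiv 𝕜 f) 0 v (X 0) + fderiv 𝕜 f 0 (fderiv 𝕜 X 0 v) = 0 := by
  have hc : DifferentiableAt 𝕜 (fderiv 𝕜 f) 0 :=
    (hf.fderiv_right (m := 1) le_rfl).differentiableAt (by simp)
  have h1 : fderiv 𝕜 (fun B => fderiv 𝕜 f B (X B)) 0 = 0 := by
    have hEq : (fun B => fderiv 𝕜 f B (X B)) =ᶠ[𝓝 (0 : E)] fun _ => (0 : F) := hinv
    rw [hEq.fderiv_eq]
    simp
  have h2 : fderiv 𝕜 (fun B => fderiv 𝕜 f B (X B)) 0 =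
      (fderiv 𝕜 f 0).comp (fderiv 𝕜 X 0) + (fderiv 𝕜 (fderiv 𝕜 f) 0).flip (X 0) :=
    fderiv_clm_apply hc hX
  have h3 := congrArg (fun T : E →L[𝕜] F => T v) (h1.symm.trans h2)
  simp only [zero_apply, add_apply, ContinuousLinearMap.coe_comp, Function.comp_apply,
    ContinuousLinearMap.flip_apply] at h3
  rw [add_comm]
  exact h3.symm

/-- **(4.13) *"For constant λ"***: if moreover the generator vanishes at the unit configuration, X(0) = 0 (∂λ = 0 for
constant λ), then Df(0)(DX(0)v) = 0 for every v — *"For constant λ we get ⟨(δ/δB)𝐄(1), iad_λB₁⟩ = 0"*.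
[cite: Balaban1987RG1, (4.13) p.284] -/
theorem fderiv_apply_generator_eq_zero {f : E → F} {X : E → E} (hf : ContDiffAt 𝕜 2 f 0)
    (hX : DifferentiableAt 𝕜 X 0) (hX0 : X 0 = 0) (hinv : ∀ᶠ B in 𝓝 (0 : E), fderiv 𝕜 f B (X B) = 0) (v : E) :
    fderiv 𝕜 f 0 (fderiv 𝕜 X 0 v) = 0 := by
  have h := ward_first_order hf hX hinv v
  rwa [hX0, map_zero, zero_add] at h

/-- **(4.13) for a LINEAR generator** (the constant gauge transformations act linearly, B ↦ Ad_{exp iλ}B, generator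
L_λ = iad_λ): f C² at 0 and Df(B)[L B] = 0 for B near 0 ⟹ Df(0) ∘ L = 0. [cite: Balaban1987RG1, (4.13) p.284] -/
theorem fderiv_comp_generator_eq_zero {f : E → F} (L : E →L[𝕜] E) (hf : ContDiffAt 𝕜 2 f 0)
    (hinv : ∀ᶠ B in 𝓝 (0 : E), fderiv 𝕜 f B (L B) = 0) : (fderiv 𝕜 f 0).comp L = 0 := by
  ext v
  have h := fderiv_apply_generator_eq_zero (X := fun B => L B) hf L.differentiableAt (map_zero L) hinv v
  rw [L.fderiv] at h
  simpa using h

/-- **(4.13) ⇒ (4.14), abstract**: if f is C² at 0, infinitesimally invariant near 0 along every linear generator L_λ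
of a family, and the ranges of the L_λ span a dense subspace (the DETECTING property — in the Lie model this is
*"since the configuration B₁ is arbitrary … The group G is semisimple, hence this is possible only for the element 0"*,
see `span_range_adConst_eq_top`), then Df(0) = 0: *"(δ/δB)𝐄(1) = 0. (4.14)"*. [cite: Balaban1987RG1, (4.13)-(4.14) p.284] -/
theorem fderiv_eq_zero_of_generators {Λ : Type*} {f : E → F} (L : Λ → E →L[𝕜] E) (hf : ContDiffAt 𝕜 2 f 0)
    (hinv : ∀ l, ∀ᶠ B in 𝓝 (0 : E), fderiv 𝕜 f B (L l B) = 0)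
    (hspan : Dense (Submodule.span 𝕜 (⋃ l, Set.range (L l)) : Set E)) : fderiv 𝕜 f 0 = 0 := by
  refine ContinuousLinearMap.ext_on hspan fun v hv => ?_
  obtain ⟨l, w, rfl⟩ : ∃ l w, L l w = v := by
    rcases Set.mem_iUnion.1 hv with ⟨l, w, hw⟩
    exact ⟨l, w, hw⟩
  have h := congrArg (fun T : E →L[𝕜] F => T w) (fderiv_comp_generator_eq_zero (L l) hf (hinv l))
  simpa using h

/-- **(4.7)–(4.14) for an ANALYTIC function, the printed setting** (*"a function 𝐄(V) defined and analytic on a domain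
of small gauge field configurations"*, (4.4) radius α): E analytic on the ball ‖B‖ < α, (4.9) for the constant gauge
transformations there — ⟨(δ/δB)𝐄(B), L_λB⟩ = 0 for ‖B‖ < α and every λ — and detecting generators ⟹ (δ/δB)𝐄(0) = 0,
the 𝐇-form hypothesis `h414` of `B12Decay510R1`. [cite: Balaban1987RG1, (4.7)-(4.14) pp.282-284] -/
theorem fderiv_eq_zero_of_analytic_invariant {E F : Type*} [NormedAddCommGroup E] [NormedSpace ℂ E]
    [NormedAddCommGroup F] [NormedSpace ℂ F] [CompleteSpace F] {Λ : Type*} {f : E → F} {α : ℝ} (hα : 0 < α)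
    (hf : AnalyticOnNhd ℂ f (ball 0 α)) (L : Λ → E →L[ℂ] E)
    (h49 : ∀ l, ∀ B ∈ ball (0 : E) α, fderiv ℂ f B (L l B) = 0)
    (hspan : Dense (Submodule.span ℂ (⋃ l, Set.range (L l)) : Set E)) : fderiv ℂ f 0 = 0 :=
  fderiv_eq_zero_of_generators L (hf 0 (mem_ball_self hα)).contDiffAt
    (fun l => Filter.eventually_of_mem (ball_mem_nhds (0 : E) hα) (h49 l)) hspan

/-! ### (4.15): the identities at B = 0 after (4.14) (v1.1) -/

/-- **(4.15), first line, abstract**: p. 284 *"We obtain the following set of Ward-Takahashi identities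
⟨(δ²/δB²)𝐄(1), B₁, ∂λ⟩ = 0, …"* — (4.13) together with (4.14) Df(0) = 0 gives D²f(0)(v, X(0)) = 0: the Hessian at the
unit configuration annihilates the pure gauge directions X_λ(0) = −∂λ.  For 𝕜 = ℝ = F this is
`Beta.WardIdentity.sndFDeriv_apply_generator_eq_zero` (Lemma W of the β sub-cell, row an2), restated over a general
normed field and codomain only because the functionals of (4.2) are complex-analytic. [cite: Balaban1987RG1, (4.15) p.284] -/
theorem hessian_apply_generator_eq_zero {f : E → F} {X : E → E} (hf : ContDiffAt 𝕜 2 f 0)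
    (hX : DifferentiableAt 𝕜 X 0) (hinv : ∀ᶠ B in 𝓝 (0 : E), fderiv 𝕜 f B (X B) = 0)
    (h414 : fderiv 𝕜 f 0 = 0) (v : E) : fderiv 𝕜 (fderiv 𝕜 f) 0 v (X 0) = 0 := by
  have h := ward_first_order hf hX hinv v
  rwa [h414, zero_apply, add_zero] at h

/-- **(4.15), first line, with (4.14) DISCHARGED**: a family of generator fields X_λ (all gauge functions λ) along each
of which f is infinitesimally invariant near 0, containing LINEAR members L_μ (the constant gauge transformations) whose
ranges span a dense subspace ⟹ D²f(0)(v, X_λ(0)) = 0 for every λ and v — *"⟨(δ²/δB²)𝐄(1), B₁, ∂λ⟩ = 0 … for an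
arbitrary gauge function λ, and arbitrary gauge fields B₁"*. [cite: Balaban1987RG1, (4.13)-(4.15) p.284] -/
theorem hessian_apply_generator_eq_zero_of_generators {Λ Λ₀ : Type*} {f : E → F} (X : Λ → E → E)
    (L : Λ₀ → E →L[𝕜] E) (hf : ContDiffAt 𝕜 2 f 0) (hX : ∀ l, DifferentiableAt 𝕜 (X l) 0)
    (hinv : ∀ l, ∀ᶠ B in 𝓝 (0 : E), fderiv 𝕜 f B (X l B) = 0)
    (hLinv : ∀ μ, ∀ᶠ B in 𝓝 (0 : E), fderiv 𝕜 f B (L μ B) = 0)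
    (hspan : Dense (Submodule.span 𝕜 (⋃ μ, Set.range (L μ)) : Set E)) (l : Λ) (v : E) :
    fderiv 𝕜 (fderiv 𝕜 f) 0 v (X l 0) = 0 :=
  hessian_apply_generator_eq_zero hf (hX l) (hinv l) (fderiv_eq_zero_of_generators L hf hLinv hspan) v

/-- **(4.15), first line, in the symmetric slot** (𝕜 = ℝ or ℂ, where second derivatives of a C² function are
symmetric): D²f(0)(X(0), v) = 0 as well. [cite: Balaban1987RG1, (4.15) p.284] -/
theorem hessian_generator_apply_eq_zero [IsRCLikeNormedField 𝕜] {f : E → F} {X : E → E}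
    (hf : ContDiffAt 𝕜 2 f 0) (hX : DifferentiableAt 𝕜 X 0) (hinv : ∀ᶠ B in 𝓝 (0 : E), fderiv 𝕜 f B (X B) = 0)
    (h414 : fderiv 𝕜 f 0 = 0) (v : E) : fderiv 𝕜 (fderiv 𝕜 f) 0 (X 0) v = 0 := by
  rw [hf.isSymmSndFDerivAt (by simp) (X 0) v]
  exact hessian_apply_generator_eq_zero hf hX hinv h414 v

/-- **(4.11)∣_{B=0}, abstract — the identity behind the second line of (4.15)** ((4.11) = the third-order member of the
printed sequence (4.10)–(4.12) on p. 283; its display is quoted at `ward_second_order_eventually` below, v1.3): if f is C³ and the generator field X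
is C² at 0 and Df(B)[X(B)] = 0 for B near 0, then for all directions v = B₁, w = B₂:
D³f(0)(v, w, X 0) + D²f(0)(v, DX(0)w) + D²f(0)(w, DX(0)v) + Df(0)(D²X(0)(v, w)) = 0 (differentiate the identically
vanishing B ↦ Df(B)[X(B)] twice: its first derivative B ↦ D²f(B)(w, X B) + Df(B)(DX(B)w) vanishes near 0, hence so does
the derivative of the latter at 0; product rule `fderiv_clm_apply` twice). [cite: Balaban1987RG1, (4.10)-(4.15) pp.283-284] -/
theorem ward_second_order {f : E → F} {X : E → E} (hf : ContDiffAt 𝕜 3 f 0) (hX : ContDiffAt 𝕜 2 X 0)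
    (hinv : ∀ᶠ B in 𝓝 (0 : E), fderiv 𝕜 f B (X B) = 0) (v w : E) :
    fderiv 𝕜 (fderiv 𝕜 (fderiv 𝕜 f)) 0 v w (X 0) + fderiv 𝕜 (fderiv 𝕜 f) 0 v (fderiv 𝕜 X 0 w)
      + fderiv 𝕜 (fderiv 𝕜 f) 0 w (fderiv 𝕜 X 0 v) + fderiv 𝕜 f 0 (fderiv 𝕜 (fderiv 𝕜 X) 0 v w) = 0 := by
  have hg0 : (fun B => fderiv 𝕜 f B (X B)) =ᶠ[𝓝 (0 : E)] fun _ => (0 : F) := hinv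
  have hDg0 : fderiv 𝕜 (fun B => fderiv 𝕜 f B (X B)) =ᶠ[𝓝 (0 : E)] fun _ => (0 : E →L[𝕜] F) := by
    filter_upwards [hg0.eventually_nhds] with B hB
    have hB' : (fun B => fderiv 𝕜 f B (X B)) =ᶠ[𝓝 B] fun _ => (0 : F) := hB
    rw [hB'.fderiv_eq]
    simp
  have hf3 : ∀ᶠ B in 𝓝 (0 : E), ContDiffAt 𝕜 3 f B := hf.eventually (by simp)
  have hX2 : ∀ᶠ B in 𝓝 (0 : E), ContDiffAt 𝕜 2 X B := hX.eventually (by simp)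
  have hφ : (fun B => fderiv 𝕜 (fderiv 𝕜 f) B w (X B) + fderiv 𝕜 f B (fderiv 𝕜 X B w)) =ᶠ[𝓝 (0 : E)]
      fun _ => (0 : F) := by
    filter_upwards [hDg0, hf3, hX2] with B hB hfB hXB
    have h1 : fderiv 𝕜 (fun B => fderiv 𝕜 f B (X B)) B =
        (fderiv 𝕜 f B).comp (fderiv 𝕜 X B) + (fderiv 𝕜 (fderiv 𝕜 f) B).flip (X B) :=
      fderiv_clm_apply ((hfB.fderiv_right (m := 2) (by norm_num)).differentiableAt (by simp))
        (hXB.differentiableAt (by simp))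
    have h2 := congrArg (fun T : E →L[𝕜] F => T w) h1
    rw [hB] at h2
    simp only [zero_apply, add_apply, ContinuousLinearMap.coe_comp, Function.comp_apply,
      ContinuousLinearMap.flip_apply] at h2
    rw [add_comm]
    exact h2.symm
  have hDφ : fderiv 𝕜 (fun B => fderiv 𝕜 (fderiv 𝕜 f) B w (X B) + fderiv 𝕜 f B (fderiv 𝕜 X B w)) 0 = 0 := by
    rw [hφ.fderiv_eq]
    simp
  have hAd : DifferentiableAt 𝕜 (fderiv 𝕜 (fderiv 𝕜 f)) 0 :=
    ((hf.fderiv_right (m := 2) (by norm_num)).fderiv_right (m := 1) (by norm_num)).differentiableAt (by simp)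
  have hfd1 : DifferentiableAt 𝕜 (fderiv 𝕜 f) 0 :=
    (hf.fderiv_right (m := 2) (by norm_num)).differentiableAt (by simp)
  have hXd : DifferentiableAt 𝕜 X 0 := hX.differentiableAt (by simp)
  have hDXd : DifferentiableAt 𝕜 (fderiv 𝕜 X) 0 :=
    (hX.fderiv_right (m := 1) (by norm_num)).differentiableAt (by simp)
  have hAw : DifferentiableAt 𝕜 (fun B => fderiv 𝕜 (fderiv 𝕜 f) B w) 0 :=
    hAd.clm_apply (differentiableAt_const w)
  have hDXw : DifferentiableAt 𝕜 (fun B => fderiv 𝕜 X B w) 0 := hDXd.clm_apply (differentiableAt_const w)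
  have eAw : fderiv 𝕜 (fun B => fderiv 𝕜 (fderiv 𝕜 f) B w) 0 = (fderiv 𝕜 (fderiv 𝕜 (fderiv 𝕜 f)) 0).flip w := by
    rw [fderiv_clm_apply hAd (differentiableAt_const w)]
    simp
  have eDXw : fderiv 𝕜 (fun B => fderiv 𝕜 X B w) 0 = (fderiv 𝕜 (fderiv 𝕜 X) 0).flip w := by
    rw [fderiv_clm_apply hDXd (differentiableAt_const w)]
    simp
  have e1 : fderiv 𝕜 (fun B => fderiv 𝕜 (fderiv 𝕜 f) B w (X B)) 0 =
      (fderiv 𝕜 (fderiv 𝕜 f) 0 w).comp (fderiv 𝕜 X 0) +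
        (fderiv 𝕜 (fun B => fderiv 𝕜 (fderiv 𝕜 f) B w) 0).flip (X 0) := fderiv_clm_apply hAw hXd
  have e2 : fderiv 𝕜 (fun B => fderiv 𝕜 f B (fderiv 𝕜 X B w)) 0 =
      (fderiv 𝕜 f 0).comp (fderiv 𝕜 (fun B => fderiv 𝕜 X B w) 0) +
        (fderiv 𝕜 (fderiv 𝕜 f) 0).flip (fderiv 𝕜 X 0 w) := fderiv_clm_apply hfd1 hDXw
  rw [fderiv_fun_add (hAw.clm_apply hXd) (hfd1.clm_apply hDXw), e1, e2, eAw, eDXw] at hDφ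
  have key := congrArg (fun T : E →L[𝕜] F => T v) hDφ
  simp only [zero_apply, add_apply, ContinuousLinearMap.coe_comp, Function.comp_apply,
    ContinuousLinearMap.flip_apply] at key
  calc fderiv 𝕜 (fderiv 𝕜 (fderiv 𝕜 f)) 0 v w (X 0) + fderiv 𝕜 (fderiv 𝕜 f) 0 v (fderiv 𝕜 X 0 w)
      + fderiv 𝕜 (fderiv 𝕜 f) 0 w (fderiv 𝕜 X 0 v) + fderiv 𝕜 f 0 (fderiv 𝕜 (fderiv 𝕜 X) 0 v w)
      = fderiv 𝕜 (fderiv 𝕜 f) 0 w (fderiv 𝕜 X 0 v) + fderiv 𝕜 (fderiv 𝕜 (fderiv 𝕜 f)) 0 v w (X 0)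
      + (fderiv 𝕜 f 0 (fderiv 𝕜 (fderiv 𝕜 X) 0 v w) + fderiv 𝕜 (fderiv 𝕜 f) 0 v (fderiv 𝕜 X 0 w)) := by abel
    _ = 0 := key

/-- **(4.15), second line, abstract**: with (4.14) Df(0) = 0 the last term of `ward_second_order` drops:
D³f(0)(v, w, X 0) + D²f(0)(v, DX(0)w) + D²f(0)(w, DX(0)v) = 0 — for the gauge generator (X_λ(0) = −∂λ,
DX_λ(0)B₂ = i[λ₋, B₂] − ½i[B₂, ∂λ]) this is *"⟨(δ³/δB³)𝐄(1), B₁, B₂, ∂λ⟩ − ⟨(δ²/δB²)𝐄(1), B₁, i[λ₋, B₂] − ½i[B₂, ∂λ]⟩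
− (B₁↔B₂) = 0"*. [cite: Balaban1987RG1, (4.15) p.284] -/
theorem ward_second_order_of_fderiv_eq_zero {f : E → F} {X : E → E} (hf : ContDiffAt 𝕜 3 f 0)
    (hX : ContDiffAt 𝕜 2 X 0) (hinv : ∀ᶠ B in 𝓝 (0 : E), fderiv 𝕜 f B (X B) = 0) (h414 : fderiv 𝕜 f 0 = 0)
    (v w : E) :
    fderiv 𝕜 (fderiv 𝕜 (fderiv 𝕜 f)) 0 v w (X 0) + fderiv 𝕜 (fderiv 𝕜 f) 0 v (fderiv 𝕜 X 0 w)
      + fderiv 𝕜 (fderiv 𝕜 f) 0 w (fderiv 𝕜 X 0 v) = 0 := by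
  have h := ward_second_order hf hX hinv v w
  rwa [h414, zero_apply, add_zero] at h

/-! ### (4.10)–(4.11) near the unit and (4.12)∣_{B=0} = the third line of (4.15) (v1.3)

p. 283: *"From this we derive a whole sequence of identities by differentiations with respect to B. For our purpose it
is enough to consider expressions with four derivatives at most."* — with `ward_third_order` below the abstract forms
of ALL FOUR printed identities (4.9)–(4.12) at B = 0, i.e. the three lines of (4.15), are kernel-checked. -/

/-- Calculus helper (product rule `fderiv_clm_apply`, evaluated): the derivative at x in the direction u of
B ↦ A(B)(Y(B)) is A(x)(DY(x)u) + (DA(x)u)(Y(x)). [folklore] -/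
theorem fderiv_eval_along {G : Type*} [NormedAddCommGroup G] [NormedSpace 𝕜 G] {A : E → G →L[𝕜] F} {Y : E → G}
    {x : E} (hA : DifferentiableAt 𝕜 A x) (hY : DifferentiableAt 𝕜 Y x) (u : E) :
    fderiv 𝕜 (fun B => A B (Y B)) x u = A x (fderiv 𝕜 Y x u) + fderiv 𝕜 A x u (Y x) := by
  rw [fderiv_clm_apply hA hY]
  simp only [add_apply, ContinuousLinearMap.coe_comp, Function.comp_apply, ContinuousLinearMap.flip_apply]

/-- Calculus helper: the derivative at x in the direction u of B ↦ A(B)(w), w fixed, is (DA(x)u)(w). [folklore] -/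
theorem fderiv_eval_const {G : Type*} [NormedAddCommGroup G] [NormedSpace 𝕜 G] {A : E → G →L[𝕜] F} {x : E}
    (hA : DifferentiableAt 𝕜 A x) (w : G) (u : E) : fderiv 𝕜 (fun B => A B w) x u = fderiv 𝕜 A x u w := by
  rw [fderiv_clm_apply hA (differentiableAt_const w)]
  simp

/-- **(4.10) for small B, abstract**: p. 283 *"⟨(δ²/δB²)𝐄(exp iB), iad_{λ₋}B − g⁻¹(iad_B)∂λ, B₁⟩
+ ⟨(δ/δB)𝐄(exp iB), iad_{λ₋}B₁ − ½iad_{B₁}∂λ − k₂{iad_{B₁}, iad_B}∂λ − …⟩ = 0, (4.10)"* — if Df(B)[X(B)] = 0 for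
B near 0, f is C² and X differentiable near 0, then FOR B NEAR 0 and every direction w = B₁:
D²f(B)(w, X(B)) + Df(B)(DX(B)w) = 0. [cite: Balaban1987RG1, (4.10) p.283] -/
theorem ward_first_order_eventually {f : E → F} {X : E → E} (hf : ∀ᶠ B in 𝓝 (0 : E), ContDiffAt 𝕜 2 f B)
    (hX : ∀ᶠ B in 𝓝 (0 : E), DifferentiableAt 𝕜 X B) (hinv : ∀ᶠ B in 𝓝 (0 : E), fderiv 𝕜 f B (X B) = 0) :
    ∀ᶠ B in 𝓝 (0 : E), ∀ w, fderiv 𝕜 (fderiv 𝕜 f) B w (X B) + fderiv 𝕜 f B (fderiv 𝕜 X B w) = 0 := by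
  have hg0 : (fun B => fderiv 𝕜 f B (X B)) =ᶠ[𝓝 (0 : E)] fun _ => (0 : F) := hinv
  have hDg0 : ∀ᶠ B in 𝓝 (0 : E), fderiv 𝕜 (fun B => fderiv 𝕜 f B (X B)) B = 0 := by
    filter_upwards [hg0.eventually_nhds] with B hB
    have hB' : (fun B => fderiv 𝕜 f B (X B)) =ᶠ[𝓝 B] fun _ => (0 : F) := hB
    rw [hB'.fderiv_eq]
    simp
  filter_upwards [hDg0, hf, hX] with B hB hfB hXB w
  have hfd : DifferentiableAt 𝕜 (fderiv 𝕜 f) B :=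
    (hfB.fderiv_right (m := 1) (by norm_num)).differentiableAt (by simp)
  have key : fderiv 𝕜 (fun B => fderiv 𝕜 f B (X B)) B w = 0 := by
    rw [hB, zero_apply]
  have e : fderiv 𝕜 (fun B => fderiv 𝕜 f B (X B)) B w =
      fderiv 𝕜 f B (fderiv 𝕜 X B w) + fderiv 𝕜 (fderiv 𝕜 f) B w (X B) := fderiv_eval_along hfd hXB w
  rw [e] at key
  rw [add_comm]
  exact key

/-- **(4.11) for small B, abstract**: p. 283 *"⟨(δ³/δB³)𝐄(exp iB), iad_{λ₋}B − g⁻¹(iad_B)∂λ, B₁, B₂⟩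
+ ⟨(δ²/δB²)𝐄(exp iB), iad_{λ₋}B₂ − ½iad_{B₂}∂λ − k₂{iad_{B₂}, iad_B}∂λ − …, B₁⟩ + (B₁↔B₂)
+ ⟨(δ/δB)𝐄(exp iB), −k₂{iad_{B₁}, iad_{B₂}}∂λ − …⟩ = 0, (4.11)"* (*"where {A, B} = AB + BA"*) — if Df(B)[X(B)] = 0
for B near 0, f is C³ and X is C² near 0, then for all directions v = B₁, w = B₂ and FOR B NEAR 0:
D³f(B)(v, w, X B) + D²f(B)(v, DX(B)w) + D²f(B)(w, DX(B)v) + Df(B)(D²X(B)(v, w)) = 0 (differentiate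
`ward_first_order_eventually`, which vanishes identically near 0). `ward_second_order` (v1.1) is the case B = 0.
[cite: Balaban1987RG1, (4.11) p.283] -/
theorem ward_second_order_eventually {f : E → F} {X : E → E} (hf : ∀ᶠ B in 𝓝 (0 : E), ContDiffAt 𝕜 3 f B)
    (hX : ∀ᶠ B in 𝓝 (0 : E), ContDiffAt 𝕜 2 X B) (hinv : ∀ᶠ B in 𝓝 (0 : E), fderiv 𝕜 f B (X B) = 0)
    (v w : E) : ∀ᶠ B in 𝓝 (0 : E),
      fderiv 𝕜 (fderiv 𝕜 (fderiv 𝕜 f)) B v w (X B) + fderiv 𝕜 (fderiv 𝕜 f) B v (fderiv 𝕜 X B w)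
        + fderiv 𝕜 (fderiv 𝕜 f) B w (fderiv 𝕜 X B v) + fderiv 𝕜 f B (fderiv 𝕜 (fderiv 𝕜 X) B v w) = 0 := by
  have h1 := ward_first_order_eventually (𝕜 := 𝕜) (hf.mono fun B h => h.of_le (by norm_num))
    (hX.mono fun B h => h.differentiableAt (by simp)) hinv
  have hφ : (fun B => fderiv 𝕜 (fderiv 𝕜 f) B w (X B) + fderiv 𝕜 f B (fderiv 𝕜 X B w)) =ᶠ[𝓝 (0 : E)]
      fun _ => (0 : F) := h1.mono fun B hB => hB w
  have hDφ : ∀ᶠ B in 𝓝 (0 : E),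
      fderiv 𝕜 (fun B => fderiv 𝕜 (fderiv 𝕜 f) B w (X B) + fderiv 𝕜 f B (fderiv 𝕜 X B w)) B = 0 := by
    filter_upwards [hφ.eventually_nhds] with B hB
    have hB' : (fun B => fderiv 𝕜 (fderiv 𝕜 f) B w (X B) + fderiv 𝕜 f B (fderiv 𝕜 X B w)) =ᶠ[𝓝 B]
        fun _ => (0 : F) := hB
    rw [hB'.fderiv_eq]
    simp
  filter_upwards [hDφ, hf, hX] with B hB hfB hXB
  have hAd : DifferentiableAt 𝕜 (fderiv 𝕜 (fderiv 𝕜 f)) B :=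
    ((hfB.fderiv_right (m := 2) (by norm_num)).fderiv_right (m := 1) (by norm_num)).differentiableAt (by simp)
  have hfd1 : DifferentiableAt 𝕜 (fderiv 𝕜 f) B :=
    (hfB.fderiv_right (m := 2) (by norm_num)).differentiableAt (by simp)
  have hXd : DifferentiableAt 𝕜 X B := hXB.differentiableAt (by simp)
  have hDXd : DifferentiableAt 𝕜 (fderiv 𝕜 X) B :=
    (hXB.fderiv_right (m := 1) (by norm_num)).differentiableAt (by simp)
  have hAw : DifferentiableAt 𝕜 (fun B => fderiv 𝕜 (fderiv 𝕜 f) B w) B :=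
    hAd.clm_apply (differentiableAt_const w)
  have hDXw : DifferentiableAt 𝕜 (fun B => fderiv 𝕜 X B w) B := hDXd.clm_apply (differentiableAt_const w)
  have key : fderiv 𝕜 (fun B => fderiv 𝕜 (fderiv 𝕜 f) B w (X B) + fderiv 𝕜 f B (fderiv 𝕜 X B w)) B v = 0 := by
    rw [hB, zero_apply]
  have e1 : fderiv 𝕜 (fun B => fderiv 𝕜 (fderiv 𝕜 f) B w (X B)) B v =
      fderiv 𝕜 (fderiv 𝕜 f) B w (fderiv 𝕜 X B v) + fderiv 𝕜 (fderiv 𝕜 (fderiv 𝕜 f)) B v w (X B) := by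
    rw [fderiv_eval_along hAw hXd v, fderiv_eval_const hAd w v]
  have e2 : fderiv 𝕜 (fun B => fderiv 𝕜 f B (fderiv 𝕜 X B w)) B v =
      fderiv 𝕜 f B (fderiv 𝕜 (fderiv 𝕜 X) B v w) + fderiv 𝕜 (fderiv 𝕜 f) B v (fderiv 𝕜 X B w) := by
    rw [fderiv_eval_along hfd1 hDXw v, fderiv_eval_const hDXd w v]
  rw [fderiv_fun_add (hAw.clm_apply hXd) (hfd1.clm_apply hDXw), add_apply, e1, e2] at key
  calc fderiv 𝕜 (fderiv 𝕜 (fderiv 𝕜 f)) B v w (X B) + fderiv 𝕜 (fderiv 𝕜 f) B v (fderiv 𝕜 X B w)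
      + fderiv 𝕜 (fderiv 𝕜 f) B w (fderiv 𝕜 X B v) + fderiv 𝕜 f B (fderiv 𝕜 (fderiv 𝕜 X) B v w)
      = fderiv 𝕜 (fderiv 𝕜 f) B w (fderiv 𝕜 X B v) + fderiv 𝕜 (fderiv 𝕜 (fderiv 𝕜 f)) B v w (X B)
      + (fderiv 𝕜 f B (fderiv 𝕜 (fderiv 𝕜 X) B v w) + fderiv 𝕜 (fderiv 𝕜 f) B v (fderiv 𝕜 X B w)) := by abel
    _ = 0 := key

/-- **(4.12)∣_{B=0}, abstract — the identity behind the third line of (4.15)**: p. 284 *"⟨(δ⁴/δB⁴)𝐄(exp iB),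
iad_{λ₋}B − g⁻¹(iad_B)∂λ, B₁, B₂, B₃⟩ + ⟨(δ³/δB³)𝐄(exp iB), iad_{λ₋}B₃ − ½iad_{B₃}∂λ − k₂{iad_{B₃}, iad_B}∂λ − …,
B₁, B₂⟩ + (B₁↔B₃) + (B₂↔B₃) + ⟨(δ²/δB²)𝐄(exp iB), −k₂{iad_{B₂}, iad_{B₃}}∂λ, B₁⟩ + (B₁↔B₂) + (B₁↔B₃)
+ ⟨(δ/δB)𝐄(exp iB), …⟩ = 0. (4.12) We are interested in the above identities at B = 0, because such expressions only
appear in the sum (4.6)."* — if Df(B)[X(B)] = 0 for B near 0, f is C⁴ and X is C³ at 0, then for all directions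
u = B₁, v = B₂, w = B₃:  D⁴f(0)(u, v, w, X 0) + D³f(0)(u, v, DX(0)w) + D³f(0)(u, w, DX(0)v) + D³f(0)(v, w, DX(0)u)
+ D²f(0)(u, D²X(0)(v, w)) + D²f(0)(v, D²X(0)(u, w)) + D²f(0)(w, D²X(0)(u, v)) + Df(0)(D³X(0)(u, v, w)) = 0
(differentiate `ward_second_order_eventually`, which vanishes identically near 0, at 0 in the direction u).
[cite: Balaban1987RG1, (4.12) p.284] -/
theorem ward_third_order {f : E → F} {X : E → E} (hf : ContDiffAt 𝕜 4 f 0) (hX : ContDiffAt 𝕜 3 X 0)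
    (hinv : ∀ᶠ B in 𝓝 (0 : E), fderiv 𝕜 f B (X B) = 0) (u v w : E) :
    fderiv 𝕜 (fderiv 𝕜 (fderiv 𝕜 (fderiv 𝕜 f))) 0 u v w (X 0)
      + fderiv 𝕜 (fderiv 𝕜 (fderiv 𝕜 f)) 0 u v (fderiv 𝕜 X 0 w)
      + fderiv 𝕜 (fderiv 𝕜 (fderiv 𝕜 f)) 0 u w (fderiv 𝕜 X 0 v)
      + fderiv 𝕜 (fderiv 𝕜 (fderiv 𝕜 f)) 0 v w (fderiv 𝕜 X 0 u)
      + fderiv 𝕜 (fderiv 𝕜 f) 0 u (fderiv 𝕜 (fderiv 𝕜 X) 0 v w)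
      + fderiv 𝕜 (fderiv 𝕜 f) 0 v (fderiv 𝕜 (fderiv 𝕜 X) 0 u w)
      + fderiv 𝕜 (fderiv 𝕜 f) 0 w (fderiv 𝕜 (fderiv 𝕜 X) 0 u v)
      + fderiv 𝕜 f 0 (fderiv 𝕜 (fderiv 𝕜 (fderiv 𝕜 X)) 0 u v w) = 0 := by
  have hf3 : ∀ᶠ B in 𝓝 (0 : E), ContDiffAt 𝕜 3 f B :=
    (hf.eventually (by simp)).mono fun B h => h.of_le (by norm_num)
  have hX2 : ∀ᶠ B in 𝓝 (0 : E), ContDiffAt 𝕜 2 X B :=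
    (hX.eventually (by simp)).mono fun B h => h.of_le (by norm_num)
  have hψ : (fun B => fderiv 𝕜 (fderiv 𝕜 (fderiv 𝕜 f)) B v w (X B) + fderiv 𝕜 (fderiv 𝕜 f) B v (fderiv 𝕜 X B w)
      + fderiv 𝕜 (fderiv 𝕜 f) B w (fderiv 𝕜 X B v) + fderiv 𝕜 f B (fderiv 𝕜 (fderiv 𝕜 X) B v w)) =ᶠ[𝓝 (0 : E)]
      fun _ => (0 : F) := ward_second_order_eventually hf3 hX2 hinv v w
  have hDψ : fderiv 𝕜 (fun B => fderiv 𝕜 (fderiv 𝕜 (fderiv 𝕜 f)) B v w (X B)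
      + fderiv 𝕜 (fderiv 𝕜 f) B v (fderiv 𝕜 X B w) + fderiv 𝕜 (fderiv 𝕜 f) B w (fderiv 𝕜 X B v)
      + fderiv 𝕜 f B (fderiv 𝕜 (fderiv 𝕜 X) B v w)) 0 = 0 := by
    rw [hψ.fderiv_eq]
    simp
  -- differentiability at 0 of the iterated derivatives
  have hD3 : DifferentiableAt 𝕜 (fderiv 𝕜 (fderiv 𝕜 (fderiv 𝕜 f))) 0 :=
    (((hf.fderiv_right (m := 3) (by norm_num)).fderiv_right (m := 2) (by norm_num)).fderiv_right (m := 1)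
      (by norm_num)).differentiableAt (by simp)
  have hD2 : DifferentiableAt 𝕜 (fderiv 𝕜 (fderiv 𝕜 f)) 0 :=
    ((hf.fderiv_right (m := 3) (by norm_num)).fderiv_right (m := 2) (by norm_num)).differentiableAt (by simp)
  have hD1 : DifferentiableAt 𝕜 (fderiv 𝕜 f) 0 := (hf.fderiv_right (m := 3) (by norm_num)).differentiableAt (by simp)
  have hX0 : DifferentiableAt 𝕜 X 0 := hX.differentiableAt (by simp)
  have hX1 : DifferentiableAt 𝕜 (fderiv 𝕜 X) 0 := (hX.fderiv_right (m := 2) (by norm_num)).differentiableAt (by simp)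
  have hXX : DifferentiableAt 𝕜 (fderiv 𝕜 (fderiv 𝕜 X)) 0 :=
    ((hX.fderiv_right (m := 2) (by norm_num)).fderiv_right (m := 1) (by norm_num)).differentiableAt (by simp)
  -- the four summands and their factors
  -- (the implicit `c`, `u` are given explicitly: at this depth of iterated `→L` spaces the elaborator does not
  -- unify the operator-norm instance chain with the directly synthesized one on its own)
  have hA1v : DifferentiableAt 𝕜 (fun B => fderiv 𝕜 (fderiv 𝕜 (fderiv 𝕜 f)) B v) 0 :=
    DifferentiableAt.clm_apply (c := fderiv 𝕜 (fderiv 𝕜 (fderiv 𝕜 f))) (u := fun _ : E => v) hD3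
      (differentiableAt_const v)
  have hA1 : DifferentiableAt 𝕜 (fun B => fderiv 𝕜 (fderiv 𝕜 (fderiv 𝕜 f)) B v w) 0 :=
    hA1v.clm_apply (differentiableAt_const w)
  have hA2 : DifferentiableAt 𝕜 (fun B => fderiv 𝕜 (fderiv 𝕜 f) B v) 0 := hD2.clm_apply (differentiableAt_const v)
  have hY2 : DifferentiableAt 𝕜 (fun B => fderiv 𝕜 X B w) 0 := hX1.clm_apply (differentiableAt_const w)
  have hA3 : DifferentiableAt 𝕜 (fun B => fderiv 𝕜 (fderiv 𝕜 f) B w) 0 := hD2.clm_apply (differentiableAt_const w)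
  have hY3 : DifferentiableAt 𝕜 (fun B => fderiv 𝕜 X B v) 0 := hX1.clm_apply (differentiableAt_const v)
  have hY4v : DifferentiableAt 𝕜 (fun B => fderiv 𝕜 (fderiv 𝕜 X) B v) 0 := hXX.clm_apply (differentiableAt_const v)
  have hY4 : DifferentiableAt 𝕜 (fun B => fderiv 𝕜 (fderiv 𝕜 X) B v w) 0 := hY4v.clm_apply (differentiableAt_const w)
  have hP1 : DifferentiableAt 𝕜 (fun B => fderiv 𝕜 (fderiv 𝕜 (fderiv 𝕜 f)) B v w (X B)) 0 := hA1.clm_apply hX0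
  have hP2 : DifferentiableAt 𝕜 (fun B => fderiv 𝕜 (fderiv 𝕜 f) B v (fderiv 𝕜 X B w)) 0 := hA2.clm_apply hY2
  have hP3 : DifferentiableAt 𝕜 (fun B => fderiv 𝕜 (fderiv 𝕜 f) B w (fderiv 𝕜 X B v)) 0 := hA3.clm_apply hY3
  have hP4 : DifferentiableAt 𝕜 (fun B => fderiv 𝕜 f B (fderiv 𝕜 (fderiv 𝕜 X) B v w)) 0 := hD1.clm_apply hY4
  have e1 : fderiv 𝕜 (fun B => fderiv 𝕜 (fderiv 𝕜 (fderiv 𝕜 f)) B v w (X B)) 0 u =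
      fderiv 𝕜 (fderiv 𝕜 (fderiv 𝕜 f)) 0 v w (fderiv 𝕜 X 0 u)
        + fderiv 𝕜 (fderiv 𝕜 (fderiv 𝕜 (fderiv 𝕜 f))) 0 u v w (X 0) := by
    rw [fderiv_eval_along hA1 hX0 u, fderiv_eval_const hA1v w u,
      fderiv_eval_const (A := fderiv 𝕜 (fderiv 𝕜 (fderiv 𝕜 f))) hD3 v u]
  have e2 : fderiv 𝕜 (fun B => fderiv 𝕜 (fderiv 𝕜 f) B v (fderiv 𝕜 X B w)) 0 u =
      fderiv 𝕜 (fderiv 𝕜 f) 0 v (fderiv 𝕜 (fderiv 𝕜 X) 0 u w)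
        + fderiv 𝕜 (fderiv 𝕜 (fderiv 𝕜 f)) 0 u v (fderiv 𝕜 X 0 w) := by
    rw [fderiv_eval_along hA2 hY2 u, fderiv_eval_const hX1 w u, fderiv_eval_const hD2 v u]
  have e3 : fderiv 𝕜 (fun B => fderiv 𝕜 (fderiv 𝕜 f) B w (fderiv 𝕜 X B v)) 0 u =
      fderiv 𝕜 (fderiv 𝕜 f) 0 w (fderiv 𝕜 (fderiv 𝕜 X) 0 u v)
        + fderiv 𝕜 (fderiv 𝕜 (fderiv 𝕜 f)) 0 u w (fderiv 𝕜 X 0 v) := by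
    rw [fderiv_eval_along hA3 hY3 u, fderiv_eval_const hX1 v u, fderiv_eval_const hD2 w u]
  have e4 : fderiv 𝕜 (fun B => fderiv 𝕜 f B (fderiv 𝕜 (fderiv 𝕜 X) B v w)) 0 u =
      fderiv 𝕜 f 0 (fderiv 𝕜 (fderiv 𝕜 (fderiv 𝕜 X)) 0 u v w)
        + fderiv 𝕜 (fderiv 𝕜 f) 0 u (fderiv 𝕜 (fderiv 𝕜 X) 0 v w) := by
    rw [fderiv_eval_along hD1 hY4 u, fderiv_eval_const hY4v w u, fderiv_eval_const hXX v u]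
  have hS12 : DifferentiableAt 𝕜 (fun B => fderiv 𝕜 (fderiv 𝕜 (fderiv 𝕜 f)) B v w (X B)
      + fderiv 𝕜 (fderiv 𝕜 f) B v (fderiv 𝕜 X B w)) 0 := hP1.add hP2
  have hS123 : DifferentiableAt 𝕜 (fun B => fderiv 𝕜 (fderiv 𝕜 (fderiv 𝕜 f)) B v w (X B)
      + fderiv 𝕜 (fderiv 𝕜 f) B v (fderiv 𝕜 X B w) + fderiv 𝕜 (fderiv 𝕜 f) B w (fderiv 𝕜 X B v)) 0 := hS12.add hP3
  rw [fderiv_fun_add hS123 hP4, fderiv_fun_add hS12 hP3, fderiv_fun_add hP1 hP2] at hDψ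
  have key := congrArg (fun T : E →L[𝕜] F => T u) hDψ
  simp only [add_apply, zero_apply] at key
  rw [e1, e2, e3, e4] at key
  calc fderiv 𝕜 (fderiv 𝕜 (fderiv 𝕜 (fderiv 𝕜 f))) 0 u v w (X 0)
      + fderiv 𝕜 (fderiv 𝕜 (fderiv 𝕜 f)) 0 u v (fderiv 𝕜 X 0 w)
      + fderiv 𝕜 (fderiv 𝕜 (fderiv 𝕜 f)) 0 u w (fderiv 𝕜 X 0 v)
      + fderiv 𝕜 (fderiv 𝕜 (fderiv 𝕜 f)) 0 v w (fderiv 𝕜 X 0 u)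
      + fderiv 𝕜 (fderiv 𝕜 f) 0 u (fderiv 𝕜 (fderiv 𝕜 X) 0 v w)
      + fderiv 𝕜 (fderiv 𝕜 f) 0 v (fderiv 𝕜 (fderiv 𝕜 X) 0 u w)
      + fderiv 𝕜 (fderiv 𝕜 f) 0 w (fderiv 𝕜 (fderiv 𝕜 X) 0 u v)
      + fderiv 𝕜 f 0 (fderiv 𝕜 (fderiv 𝕜 (fderiv 𝕜 X)) 0 u v w)
      = fderiv 𝕜 (fderiv 𝕜 (fderiv 𝕜 f)) 0 v w (fderiv 𝕜 X 0 u)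
        + fderiv 𝕜 (fderiv 𝕜 (fderiv 𝕜 (fderiv 𝕜 f))) 0 u v w (X 0)
      + (fderiv 𝕜 (fderiv 𝕜 f) 0 v (fderiv 𝕜 (fderiv 𝕜 X) 0 u w)
        + fderiv 𝕜 (fderiv 𝕜 (fderiv 𝕜 f)) 0 u v (fderiv 𝕜 X 0 w))
      + (fderiv 𝕜 (fderiv 𝕜 f) 0 w (fderiv 𝕜 (fderiv 𝕜 X) 0 u v)
        + fderiv 𝕜 (fderiv 𝕜 (fderiv 𝕜 f)) 0 u w (fderiv 𝕜 X 0 v))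
      + (fderiv 𝕜 f 0 (fderiv 𝕜 (fderiv 𝕜 (fderiv 𝕜 X)) 0 u v w)
        + fderiv 𝕜 (fderiv 𝕜 f) 0 u (fderiv 𝕜 (fderiv 𝕜 X) 0 v w)) := by abel
    _ = 0 := key

/-- **(4.15), third line, abstract**: with (4.14) Df(0) = 0 the last term of `ward_third_order` drops — for the gauge
generator (X_λ(0) = −∂λ, DX_λ(0)B₃ = i[λ₋, B₃] − ½i[B₃, ∂λ], D²X_λ(0)(B₂, B₃) = −k₂{iad_{B₂}, iad_{B₃}}∂λ; the printed
line is (−1)× the identity below, its last slot written with ∂λ = −X_λ(0)) this is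
p. 284 *"⟨(δ⁴/δB⁴)𝐄(1), B₁, B₂, B₃, ∂λ⟩ − ⟨(δ³/δB³)𝐄(1), B₁, B₂, i[λ₋, B₃] − ½i[B₃, ∂λ]⟩ − (B₃↔B₂) − (B₃↔B₁)
+ ⟨(δ²/δB²)𝐄(1), B₁, k₂{iad_{B₂}, iad_{B₃}}∂λ⟩ + (B₁↔B₂) + (B₁↔B₃) = 0, (4.15) for an arbitrary gauge function λ,
and arbitrary gauge fields B₁, B₂, B₃."* [cite: Balaban1987RG1, (4.15) p.284] -/
theorem ward_third_order_of_fderiv_eq_zero {f : E → F} {X : E → E} (hf : ContDiffAt 𝕜 4 f 0)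
    (hX : ContDiffAt 𝕜 3 X 0) (hinv : ∀ᶠ B in 𝓝 (0 : E), fderiv 𝕜 f B (X B) = 0) (h414 : fderiv 𝕜 f 0 = 0)
    (u v w : E) :
    fderiv 𝕜 (fderiv 𝕜 (fderiv 𝕜 (fderiv 𝕜 f))) 0 u v w (X 0)
      + fderiv 𝕜 (fderiv 𝕜 (fderiv 𝕜 f)) 0 u v (fderiv 𝕜 X 0 w)
      + fderiv 𝕜 (fderiv 𝕜 (fderiv 𝕜 f)) 0 u w (fderiv 𝕜 X 0 v)
      + fderiv 𝕜 (fderiv 𝕜 (fderiv 𝕜 f)) 0 v w (fderiv 𝕜 X 0 u)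
      + fderiv 𝕜 (fderiv 𝕜 f) 0 u (fderiv 𝕜 (fderiv 𝕜 X) 0 v w)
      + fderiv 𝕜 (fderiv 𝕜 f) 0 v (fderiv 𝕜 (fderiv 𝕜 X) 0 u w)
      + fderiv 𝕜 (fderiv 𝕜 f) 0 w (fderiv 𝕜 (fderiv 𝕜 X) 0 u v) = 0 := by
  have h := ward_third_order hf hX hinv u v w
  rwa [h414, zero_apply, add_zero] at h

end Ward

/-! ## 2. The detecting step in the Lie model: *"since B₁ is arbitrary … G is semisimple"* -/

section Lie

variable {K : Type*} [CommRing K] {𝔤 : Type*} [LieRing 𝔤] [LieAlgebra K 𝔤] {ι : Type*}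

/-- The generator of a CONSTANT gauge transformation λ ∈ 𝐠 on 𝐠-valued configurations B on the bonds ι:
(ad_λB)(b) = [λ, B(b)] — the *"iad_λB₁"* of (4.13) (the factor i absorbed in the identification 𝐠 ↔ i𝐠 of V = exp iB).
[cite: Balaban1987RG1, (4.13) p.284] -/
def adConst (l : 𝔤) : (ι → 𝔤) →ₗ[K] (ι → 𝔤) where
  toFun B := fun x => ⁅l, B x⁆
  map_add' B B' := by
    funext x
    simp
  map_smul' c B := by
    funext x
    simp

/-- (ad_λB)(b) = [λ, B(b)]. [cite: Balaban1987RG1, (4.13) p.284] -/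
@[simp] theorem adConst_apply (l : 𝔤) (B : ι → 𝔤) (x : ι) : adConst (K := K) l B x = ⁅l, B x⁆ := rfl

variable [Fintype ι]

/-- The pairing *"⟨·, ·⟩"* of 𝐠-valued configurations through a bilinear form Φ on 𝐠, summed over the bonds:
⟨F, B⟩ = Σ_b Φ(F(b), B(b)) (for 𝐠 ⊂ u(N), Φ = the invariant trace form). [cite: Balaban1987RG1, (4.9) p.283] -/
def pairing (Φ : LinearMap.BilinForm K 𝔤) (F B : ι → 𝔤) : K := ∑ x, Φ (F x) (B x)

/-- ⟨F, 0⟩ = 0. [folklore] -/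
@[simp] theorem pairing_zero_right (Φ : LinearMap.BilinForm K 𝔤) (F : ι → 𝔤) : pairing Φ F 0 = 0 := by
  simp [pairing]

/-- ⟨0, B⟩ = 0. [folklore] -/
@[simp] theorem pairing_zero_left (Φ : LinearMap.BilinForm K 𝔤) (B : ι → 𝔤) : pairing Φ 0 B = 0 := by
  simp [pairing]

variable [DecidableEq ι]

/-- *"since the configuration B₁ is arbitrary"*: testing ⟨F, ad_λB₁⟩ = 0 on B₁ = a configuration supported on one bond
gives Φ(F(b), [λ, c]) = 0 for every bond b and all λ, c ∈ 𝐠. [cite: Balaban1987RG1, (4.13) p.284] -/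
theorem apply_lie_eq_zero_of_pairing_adConst (Φ : LinearMap.BilinForm K 𝔤) (F : ι → 𝔤)
    (h : ∀ (l : 𝔤) (B : ι → 𝔤), pairing Φ F (adConst (K := K) l B) = 0) (x : ι) (l c : 𝔤) :
    Φ (F x) ⁅l, c⁆ = 0 := by
  have h1 := h l (Pi.single x c)
  unfold pairing at h1
  rw [Finset.sum_eq_single x (fun y _ hy => by simp [Pi.single_eq_of_ne hy])
    (fun hx => (hx (Finset.mem_univ x)).elim)] at h1
  simpa using h1

/-- **The printed step (4.13) ⇒ (4.14) in the Lie model**: p. 284 *"For constant λ we get ⟨(δ/δB)𝐄(1), iad_λB₁⟩ = 0,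
and since the configuration B₁ is arbitrary, we get [λ, (δ/δB)𝐄(1)] = 0 for all λ ∈ 𝐠ᶜ. The group G is semisimple,
hence this is possible only for the element 0 in the algebra 𝐠ᶜ."* — for an ad-INVARIANT bilinear form Φ
(Φ([a, b], c) = −Φ(b, [a, c])) WITHOUT NULL VECTORS on a SEMISIMPLE 𝐠: a configuration F with ⟨F, ad_λB₁⟩ = 0 for all
λ, B₁ is 0 (invariance turns Φ(F(b), [λ, c]) = 0 ∀c into [λ, F(b)] Φ-orthogonal to everything, hence 0; then the centre
of 𝐠 is trivial, `B12Decay510R1.eq_zero_of_forall_lie_eq_zero`). [cite: Balaban1987RG1, (4.13)-(4.14) p.284] -/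
theorem eq_zero_of_pairing_adConst_eq_zero [LieAlgebra.IsSemisimple K 𝔤] (Φ : LinearMap.BilinForm K 𝔤)
    (hΦinv : Φ.lieInvariant 𝔤) (hΦnd : ∀ a : 𝔤, (∀ b, Φ a b = 0) → a = 0) (F : ι → 𝔤)
    (h : ∀ (l : 𝔤) (B : ι → 𝔤), pairing Φ F (adConst (K := K) l B) = 0) : F = 0 := by
  have h1 := apply_lie_eq_zero_of_pairing_adConst Φ F h
  have h2 : ∀ (l : 𝔤) (x : ι), ⁅l, F x⁆ = 0 := fun l x =>
    hΦnd _ fun c => by rw [hΦinv, h1, neg_zero]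
  exact eq_zero_of_forall_lie_eq_zero (R := K) F h2

/-- **The Killing-form instance**: for a finite-dimensional Lie algebra over a field with non-singular Killing form
(Mathlib `LieAlgebra.IsKilling` — by Cartan's criterion the semisimple ones in characteristic 0, e.g. 𝐠ᶜ = 𝔰𝔩(N, ℂ) for
G = SU(N)), ⟨F, ad_λB₁⟩_Killing = 0 for all λ, B₁ ⟹ F = 0. [cite: Balaban1987RG1, (4.13)-(4.14) p.284] -/
theorem eq_zero_of_killing_adConst_eq_zero {K : Type*} [Field K] {𝔤 : Type*} [LieRing 𝔤] [LieAlgebra K 𝔤]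
    [Module.Finite K 𝔤] [LieAlgebra.IsKilling K 𝔤] {ι : Type*} [Fintype ι] [DecidableEq ι] (F : ι → 𝔤)
    (h : ∀ (l : 𝔤) (B : ι → 𝔤), pairing (killingForm K 𝔤) F (adConst (K := K) l B) = 0) : F = 0 :=
  eq_zero_of_pairing_adConst_eq_zero (killingForm K 𝔤) (LieModule.traceForm_lieInvariant K 𝔤 𝔤)
    (fun a ha => by
      have hk : a ∈ LinearMap.ker (killingForm K 𝔤) := LinearMap.mem_ker.2 (LinearMap.ext ha)
      simpa [LieAlgebra.IsKilling.ker_killingForm_eq_bot] using hk) F h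

/-- Every linear functional on the configurations is a pairing ⟨F, ·⟩ when Φ is nondegenerate and 𝐠 is
finite-dimensional over a field (Riesz through Φ, bond by bond): the identification of (δ/δB)𝐄(1) with a 𝐠ᶜ-valued
configuration used on p. 284. [folklore] -/
theorem exists_pairing_eq {K : Type*} [Field K] {𝔤 : Type*} [LieRing 𝔤] [LieAlgebra K 𝔤] [FiniteDimensional K 𝔤]
    {ι : Type*} [Fintype ι] [DecidableEq ι] (Φ : LinearMap.BilinForm K 𝔤) (hΦ : Φ.Nondegenerate)
    (f : (ι → 𝔤) →ₗ[K] K) : ∃ F : ι → 𝔤, ∀ B, f B = pairing Φ F B := by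
  refine ⟨fun x => (Φ.toDual hΦ).symm (f ∘ₗ LinearMap.single K (fun _ : ι => 𝔤) x), fun B => ?_⟩
  have hB : B = ∑ x, Pi.single x (B x) := (Finset.univ_sum_single B).symm
  conv_lhs => rw [hB]
  rw [map_sum]
  unfold pairing
  refine Finset.sum_congr rfl fun x _ => ?_
  rw [LinearMap.BilinForm.apply_toDual_symm_apply]
  simp

/-- **The detecting property IS semisimplicity (with an invariant nondegenerate form)**: over a field, for 𝐠
finite-dimensional and semisimple with an ad-invariant nondegenerate bilinear form Φ, the ranges of the constant-gauge
generators ad_λ SPAN the whole configuration space — so the hypothesis `hspan` of `fderiv_eq_zero_of_generators` holds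
in the Lie model (with any norm: a subspace equal to ⊤ is dense).  Proof: a proper span is annihilated by a non-zero
functional (`Submodule.exists_dual_map_eq_bot_of_lt_top`), which is a pairing ⟨F, ·⟩ (`exists_pairing_eq`), and then
F = 0 by `eq_zero_of_pairing_adConst_eq_zero`. [cite: Balaban1987RG1, (4.13)-(4.14) p.284] -/
theorem span_range_adConst_eq_top {K : Type*} [Field K] {𝔤 : Type*} [LieRing 𝔤] [LieAlgebra K 𝔤]
    [FiniteDimensional K 𝔤] [LieAlgebra.IsSemisimple K 𝔤] {ι : Type*} [Fintype ι] [DecidableEq ι]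
    (Φ : LinearMap.BilinForm K 𝔤) (hΦinv : Φ.lieInvariant 𝔤) (hΦ : Φ.Nondegenerate) :
    Submodule.span K (⋃ l : 𝔤, Set.range (adConst (K := K) (ι := ι) l)) = ⊤ := by
  by_contra hne
  obtain ⟨f, hf0, hfp⟩ :=
    Submodule.exists_dual_map_eq_bot_of_lt_top (lt_top_iff_ne_top.2 hne) inferInstance
  obtain ⟨F, hF⟩ := exists_pairing_eq Φ hΦ f
  have hvan : ∀ (l : 𝔤) (B : ι → 𝔤), pairing Φ F (adConst (K := K) l B) = 0 := by
    intro l B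
    rw [← hF]
    have hmem : adConst (K := K) l B ∈ Submodule.span K (⋃ l : 𝔤, Set.range (adConst (K := K) (ι := ι) l)) :=
      Submodule.subset_span (Set.mem_iUnion.2 ⟨l, B, rfl⟩)
    have hin : f (adConst (K := K) l B) ∈
        Submodule.map f (Submodule.span K (⋃ l : 𝔤, Set.range (adConst (K := K) (ι := ι) l))) :=
      Submodule.mem_map_of_mem hmem
    rw [hfp] at hin
    simpa using hin
  have hF0 : F = 0 := eq_zero_of_pairing_adConst_eq_zero Φ hΦinv (fun a ha => hΦ.1 a ha) F hvan
  apply hf0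
  refine LinearMap.ext fun B => ?_
  rw [hF, hF0, pairing_zero_left, LinearMap.zero_apply]

/-- `span_range_adConst_eq_top` for the KILLING form (Mathlib `LieAlgebra.IsKilling`: finite-dimensional 𝐠 over a field
with non-singular Killing form — semisimple, `LieAlgebra.IsKilling.instSemisimple`). [cite: Balaban1987RG1, (4.13)-(4.14) p.284] -/
theorem span_range_adConst_eq_top_of_isKilling {K : Type*} [Field K] {𝔤 : Type*} [LieRing 𝔤] [LieAlgebra K 𝔤]
    [Module.Finite K 𝔤] [LieAlgebra.IsKilling K 𝔤] {ι : Type*} [Fintype ι] [DecidableEq ι] :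
    Submodule.span K (⋃ l : 𝔤, Set.range (adConst (K := K) (ι := ι) l)) = ⊤ :=
  span_range_adConst_eq_top (killingForm K 𝔤) (LieModule.traceForm_lieInvariant K 𝔤 𝔤)
    (LieAlgebra.IsKilling.killingForm_nondegenerate K 𝔤)

/-! ### Transport of the detecting property to any configuration space (v1.1) -/

/-- A linear equivalence e : V ≃ M conjugating a generator family L on V to a family L′ on M (e ∘ L_λ = L′_λ ∘ e)
transports "the ranges span everything": span(⋃ range L′_λ) = ⊤ ⟹ span(⋃ range L_λ) = ⊤. [folklore] -/
theorem span_range_eq_top_of_conj {K : Type*} [Field K] {V M : Type*} [AddCommGroup V] [Module K V]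
    [AddCommGroup M] [Module K M] (e : V ≃ₗ[K] M) {Λ : Type*} (L : Λ → V →ₗ[K] V) (L' : Λ → M →ₗ[K] M)
    (hconj : ∀ l v, e (L l v) = L' l (e v)) (htop : Submodule.span K (⋃ l, Set.range (L' l)) = ⊤) :
    Submodule.span K (⋃ l, Set.range (L l)) = ⊤ := by
  have hle : Submodule.map (e.symm : M →ₗ[K] V) (Submodule.span K (⋃ l, Set.range (L' l))) ≤
      Submodule.span K (⋃ l, Set.range (L l)) := by
    rw [Submodule.map_span_le]
    intro m hm
    obtain ⟨l, w, rfl⟩ : ∃ l w, L' l w = m := by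
      rcases Set.mem_iUnion.1 hm with ⟨l, w, hw⟩
      exact ⟨l, w, hw⟩
    refine Submodule.subset_span (Set.mem_iUnion.2 ⟨l, e.symm w, ?_⟩)
    apply e.injective
    simp [hconj]
  rw [htop, Submodule.map_top, LinearEquiv.range] at hle
  exact top_le_iff.1 hle

/-- **The hypothesis `hspan` HOLDS on any normed configuration space identified with (bonds → 𝐠)**: E a normed
𝕜-space, 𝐠 a finite-dimensional semisimple Lie algebra over 𝕜 with an ad-invariant nondegenerate bilinear form Φ, ι a
finite set of bonds, e : E ≃ₗ[𝕜] (ι → 𝐠) ANY 𝕜-linear identification (no continuity asked) conjugating the generators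
L_λ ∈ E →L[𝕜] E to ad_λ ⟹ the ranges of the L_λ span a dense subspace of E (indeed all of E,
`span_range_eq_top_of_conj` + `span_range_adConst_eq_top`).  For a finite window of the lattice the configuration space
is of this form with any norm, in particular with the (4.4)-norm. [cite: Balaban1987RG1, (4.13)-(4.14) p.284] -/
theorem dense_span_range_of_conj_adConst {𝕜 : Type*} [NontriviallyNormedField 𝕜] {E : Type*}
    [NormedAddCommGroup E] [NormedSpace 𝕜 E] {𝔤 : Type*} [LieRing 𝔤] [LieAlgebra 𝕜 𝔤] [FiniteDimensional 𝕜 𝔤]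
    [LieAlgebra.IsSemisimple 𝕜 𝔤] (Φ : LinearMap.BilinForm 𝕜 𝔤) (hΦinv : Φ.lieInvariant 𝔤) (hΦ : Φ.Nondegenerate)
    {ι : Type*} [Fintype ι] [DecidableEq ι] (e : E ≃ₗ[𝕜] (ι → 𝔤)) {Λ : Type*} (lam : Λ → 𝔤)
    (hlam : Function.Surjective lam) (L : Λ → E →L[𝕜] E)
    (hconj : ∀ l v, e (L l v) = adConst (K := 𝕜) (lam l) (e v)) :
    Dense (Submodule.span 𝕜 (⋃ l, Set.range (L l)) : Set E) := by
  have htop' : Submodule.span 𝕜 (⋃ l : Λ, Set.range (adConst (K := 𝕜) (ι := ι) (lam l))) = ⊤ := by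
    apply top_le_iff.1
    rw [← span_range_adConst_eq_top (ι := ι) Φ hΦinv hΦ]
    apply Submodule.span_mono
    intro B hB
    rcases Set.mem_iUnion.1 hB with ⟨g, w, hw⟩
    obtain ⟨l, rfl⟩ := hlam g
    exact Set.mem_iUnion.2 ⟨l, w, hw⟩
  have htop : Submodule.span 𝕜 (⋃ l, Set.range ((L l : E →ₗ[𝕜] E))) = ⊤ :=
    span_range_eq_top_of_conj e (fun l => (L l : E →ₗ[𝕜] E)) (fun l => adConst (K := 𝕜) (lam l))
      (fun l v => hconj l v) htop'
  have hset : (Submodule.span 𝕜 (⋃ l, Set.range (L l)) : Set E) = Set.univ := by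
    have : Submodule.span 𝕜 (⋃ l, Set.range (L l)) = ⊤ := by
      simpa only [ContinuousLinearMap.coe_coe] using htop
    rw [this]
    rfl
  rw [hset]
  exact dense_univ

/-! ### Semisimplicity alone (characteristic 0): Cartan's criterion (v1.2) -/

/-- **`hspan` from *"The group G is semisimple"* ALONE**: over a field of characteristic 0, for 𝐠 finite-dimensional
and semisimple, the ranges of the ad_λ span the whole configuration space — the invariant nondegenerate form of
`span_range_adConst_eq_top` is the Killing form, nondegenerate by Cartan's criterion (Mathlib
`LieAlgebra.HasTrivialRadical.instIsKilling`; cross-read GAPS C-adv2-26, R2). [cite: Balaban1987RG1, (4.13)-(4.14) p.284] -/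
theorem span_range_adConst_eq_top_of_isSemisimple {K : Type*} [Field K] [CharZero K] {𝔤 : Type*} [LieRing 𝔤]
    [LieAlgebra K 𝔤] [FiniteDimensional K 𝔤] [LieAlgebra.IsSemisimple K 𝔤] {ι : Type*} [Fintype ι]
    [DecidableEq ι] : Submodule.span K (⋃ l : 𝔤, Set.range (adConst (K := K) (ι := ι) l)) = ⊤ :=
  span_range_adConst_eq_top_of_isKilling

/-- `dense_span_range_of_conj_adConst` with semisimplicity alone (normed field of characteristic 0, e.g. ℂ).
[cite: Balaban1987RG1, (4.13)-(4.14) p.284] -/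
theorem dense_span_range_of_conj_adConst_of_isSemisimple {𝕜 : Type*} [NontriviallyNormedField 𝕜] [CharZero 𝕜]
    {E : Type*} [NormedAddCommGroup E] [NormedSpace 𝕜 E] {𝔤 : Type*} [LieRing 𝔤] [LieAlgebra 𝕜 𝔤]
    [FiniteDimensional 𝕜 𝔤] [LieAlgebra.IsSemisimple 𝕜 𝔤] {ι : Type*} [Fintype ι] [DecidableEq ι]
    (e : E ≃ₗ[𝕜] (ι → 𝔤)) {Λ : Type*} (lam : Λ → 𝔤) (hlam : Function.Surjective lam) (L : Λ → E →L[𝕜] E)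
    (hconj : ∀ l v, e (L l v) = adConst (K := 𝕜) (lam l) (e v)) :
    Dense (Submodule.span 𝕜 (⋃ l, Set.range (L l)) : Set E) :=
  dense_span_range_of_conj_adConst (killingForm 𝕜 𝔤) (LieModule.traceForm_lieInvariant 𝕜 𝔤 𝔤)
    (LieAlgebra.IsKilling.killingForm_nondegenerate 𝕜 𝔤) e lam hlam L hconj

end Lie

/-! ## 3. Capstone: (5.10) from the census of residual printed leaves (BETA-SPEC §6 row (U)) -/

section Window

open Literature.MathematicalPhysics.QuantumFieldTheory.Balaban1983to89.B13ScaleTransfer (Pt)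
open Literature.MathematicalPhysics.QuantumFieldTheory.Balaban1983to89.TreeLength (treeLen)
open Literature.MathematicalPhysics.QuantumFieldTheory.Balaban1983to89.TreeLengthCubeSystem (Dom sys cubeSys)
open Literature.MathematicalPhysics.QuantumFieldTheory.Balaban1983to89.B12TreeDecay (K₀ kappa₀)
open Literature.MathematicalPhysics.QuantumFieldTheory.Balaban1983to89.B12Decay510Window (geom nearest)
open Literature.MathematicalPhysics.QuantumFieldTheory.Balaban1983to89.B12Sec2to5 (l1)

variable {I : Type*}

/-- **(5.10) on exhausting windows of ℤᵈ from the residual leaves, (4.14) in 𝐇-form**: the hypotheses of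
`B12Decay510FromB11.decay510_window_190` EXCEPT that the two-point function is given by the FULL n = 2 form of (4.3)
(`hrepr43`: r = 2 member + r = 1 member along the n(p) = 2 block direction h⁽²⁾, NO bound on h⁽²⁾ assumed), plus the
𝐇-form `h414` of (4.14) for each E_X ⟹ `Decay510 P (4E₀α₂⁻²(Cκ̄_Bcm)² e^{2dδ₁} K₀(4·2ᵈ, 2d) K₁(τθ/2)) δ₁`,
δ₁ = ½ min{τθ, κ/d} — the printed (4.35) constant, no n(p) ≥ 2 input.
[cite: Balaban1987RG1, (4.3) p.281, (4.14) p.284, (4.35) p.290, (5.10) p.293; Balaban1985Variational, (190) p.308] -/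
theorem decay510_window_414_190 {d : ℕ} (hd : 0 < d) (B : ℕ → Finset (Pt d)) (Wn : ℕ → Type*)
    [∀ n, NormedAddCommGroup (Wn n)] [∀ n, NormedSpace ℂ (Wn n)]
    (EXn : (n : ℕ) → Dom (B n) → Wn n → ℂ) (h2n : (n : ℕ) → Dom (B n) → Pt d → Pt d → Wn n)
    (E2n : (n : ℕ) → Dom (B n) → Pt d → Pt d → ℝ) (P : Pt d → ℝ)
    (gn : ℕ → B6.Geometry) (FBn FAn : ℕ → Type) [∀ n, AddCommGroup (FBn n)] [∀ n, Module ℝ (FBn n)]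
    [∀ n, AddCommGroup (FAn n)] [∀ n, Module ℝ (FAn n)] (bBn : (n : ℕ) → BlockNorm (gn n) (FBn n))
    (boutn : (n : ℕ) → I → BlockNorm (gn n) (FAn n)) (dHn : (n : ℕ) → FBn n →ₗ[ℝ] FAn n)
    (blkn : (n : ℕ) → Dom (B n) → Finset (gn n).Site) (ιn : (n : ℕ) → Dom (B n) → FAn n → Wn n)
    (un : (n : ℕ) → Pt d → FBn n) {Cst δ₀ σ τ c m θ κB α₂ E₀ κ : ℝ}
    (h190 : ∀ n i, Ineq190 (bBn n) (boutn n i) (dHn n) Cst δ₀) (hC : 0 ≤ Cst)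
    (hdist : ∀ n (a b : (gn n).Site), 0 ≤ (gn n).dist a b) (hrow : ∀ n, RowSum (gn n) σ c) (hc : 0 ≤ c)
    (hτ : 0 < τ) (hθ : 0 < θ) (hστ : σ + τ ≤ δ₀ / 8) (hκB : ∀ n, (bBn n).κ ≤ κB)
    (hN : ∀ n, NormDominated (S := sys (B n)) (boutn n) (blkn n) (V := fun _ => Wn n) (ιn n)) (hm₀ : 0 ≤ m)
    (hm : ∀ n x y', (bBn n).loc y' (un n x) ≤ m)
    (hD : ∀ n, UnitFieldsLocalised (bBn n) (geom (B n)) (blkn n) (un n) θ)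
    (hα₂ : 0 < α₂) (hE₀ : 0 ≤ E₀) (hκ : kappa₀ (4 * 2 ^ d) (2 * d) ≤ κ / 2)
    (han : ∀ n X, AnalyticOnNhd ℂ (EXn n X) (ball 0 α₂))
    (h118 : ∀ n X, ∀ v ∈ ball (0 : Wn n) α₂, ‖EXn n X v‖ ≤ E₀ * Real.exp (-κ * treeLen X.1))
    (h414 : ∀ n X, fderiv ℂ (EXn n X) 0 = 0)
    (hrepr43 : ∀ n X x y, E2n n X x y =
      (mixedDeriv (EXn n X) (ιn n X (dHn n (un n x))) (ιn n X (dHn n (un n y)))).re +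
        (firstDeriv (EXn n X) (h2n n X x y)).re)
    (hlim : ∀ z, Tendsto (fun n => ∑ X : Dom (B n), E2n n X 0 z) atTop (𝓝 (P z))) :
    B12Sec2to5.Decay510 P (4 * E₀ / α₂ ^ 2 * (Cst * κB * c * m) ^ 2 * Real.exp (delta1 (τ * θ) κ d * d * 2) *
      K₀ (4 * 2 ^ d) (2 * d) * B12Decay510Window.K₁ d (τ * θ / 2)) (delta1 (τ * θ) κ d) :=
  decay510_window_190 hd B Wn EXn E2n P gn FBn FAn bBn boutn dHn blkn ιn un h190 hC hdist hrow hc hτ hθ hστ hκB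
    hN hm₀ hm hD hα₂ hE₀ hκ han h118
    (fun n => repr435_of_repr43 (S := sys (B n)) (Λ := Pt d) (EXn n) (fun X x => ιn n X (dHn n (un n x)))
      (h2n n) (E2n n) hα₂ (han n) (h414 n) (hrepr43 n))
    hlim

/-- **(5.10) on exhausting windows of ℤᵈ from the residual leaves, (4.14) DISCHARGED to (4.7)/(4.9) + semisimplicity**:
as `decay510_window_414_190` but, instead of `h414`, each E_X is infinitesimally invariant on the (4.4)-ball under a
family of linear generators L_λ (the constant gauge transformations, (4.9) with ∂λ = 0: `h49`) whose ranges span a dense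
subspace (`hspan`, = semisimplicity in the Lie model, `span_range_adConst_eq_top`) ⟹ the same `Decay510` conclusion.
THE HYPOTHESIS LIST IS THE CENSUS OF RESIDUAL PRINTED LEAVES of the (5.10) ⇒ ∣β∣ ≤ β′ chain on the B12 §4–§5 side:
(4.3) at n = 2, (4.4)/(1.18) analyticity and size, (4.7) gauge invariance, semisimplicity, [15] (190), [3] (2.61), the
three dictionary hypotheses (4.4)-norm/local sizes, unit-field size, localisation, the window geometry and the limit
(5.1) — and NO n(p) ≥ 2 tree-graph input of [15] Sect. G.
[cite: Balaban1987RG1, (4.3) p.281, (4.7)-(4.14) pp.282-284, (4.35) p.290, (5.10) p.293; Balaban1985Variational, (190) p.308;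
Balaban1984PropagatorsII, Lemma 2.1 (2.61) p.234] -/
theorem decay510_window_ward_190 {d : ℕ} (hd : 0 < d) (B : ℕ → Finset (Pt d)) (Wn : ℕ → Type*)
    [∀ n, NormedAddCommGroup (Wn n)] [∀ n, NormedSpace ℂ (Wn n)] (Λg : ℕ → Type*)
    (Ln : (n : ℕ) → Λg n → (Wn n →L[ℂ] Wn n))
    (EXn : (n : ℕ) → Dom (B n) → Wn n → ℂ) (h2n : (n : ℕ) → Dom (B n) → Pt d → Pt d → Wn n)
    (E2n : (n : ℕ) → Dom (B n) → Pt d → Pt d → ℝ) (P : Pt d → ℝ)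
    (gn : ℕ → B6.Geometry) (FBn FAn : ℕ → Type) [∀ n, AddCommGroup (FBn n)] [∀ n, Module ℝ (FBn n)]
    [∀ n, AddCommGroup (FAn n)] [∀ n, Module ℝ (FAn n)] (bBn : (n : ℕ) → BlockNorm (gn n) (FBn n))
    (boutn : (n : ℕ) → I → BlockNorm (gn n) (FAn n)) (dHn : (n : ℕ) → FBn n →ₗ[ℝ] FAn n)
    (blkn : (n : ℕ) → Dom (B n) → Finset (gn n).Site) (ιn : (n : ℕ) → Dom (B n) → FAn n → Wn n)
    (un : (n : ℕ) → Pt d → FBn n) {Cst δ₀ σ τ c m θ κB α₂ E₀ κ : ℝ}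
    (h190 : ∀ n i, Ineq190 (bBn n) (boutn n i) (dHn n) Cst δ₀) (hC : 0 ≤ Cst)
    (hdist : ∀ n (a b : (gn n).Site), 0 ≤ (gn n).dist a b) (hrow : ∀ n, RowSum (gn n) σ c) (hc : 0 ≤ c)
    (hτ : 0 < τ) (hθ : 0 < θ) (hστ : σ + τ ≤ δ₀ / 8) (hκB : ∀ n, (bBn n).κ ≤ κB)
    (hN : ∀ n, NormDominated (S := sys (B n)) (boutn n) (blkn n) (V := fun _ => Wn n) (ιn n)) (hm₀ : 0 ≤ m)
    (hm : ∀ n x y', (bBn n).loc y' (un n x) ≤ m)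
    (hD : ∀ n, UnitFieldsLocalised (bBn n) (geom (B n)) (blkn n) (un n) θ)
    (hα₂ : 0 < α₂) (hE₀ : 0 ≤ E₀) (hκ : kappa₀ (4 * 2 ^ d) (2 * d) ≤ κ / 2)
    (han : ∀ n X, AnalyticOnNhd ℂ (EXn n X) (ball 0 α₂))
    (h118 : ∀ n X, ∀ v ∈ ball (0 : Wn n) α₂, ‖EXn n X v‖ ≤ E₀ * Real.exp (-κ * treeLen X.1))
    (h49 : ∀ n X l, ∀ A ∈ ball (0 : Wn n) α₂, fderiv ℂ (EXn n X) A (Ln n l A) = 0)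
    (hspan : ∀ n, Dense (Submodule.span ℂ (⋃ l, Set.range (Ln n l)) : Set (Wn n)))
    (hrepr43 : ∀ n X x y, E2n n X x y =
      (mixedDeriv (EXn n X) (ιn n X (dHn n (un n x))) (ιn n X (dHn n (un n y)))).re +
        (firstDeriv (EXn n X) (h2n n X x y)).re)
    (hlim : ∀ z, Tendsto (fun n => ∑ X : Dom (B n), E2n n X 0 z) atTop (𝓝 (P z))) :
    B12Sec2to5.Decay510 P (4 * E₀ / α₂ ^ 2 * (Cst * κB * c * m) ^ 2 * Real.exp (delta1 (τ * θ) κ d * d * 2) *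
      K₀ (4 * 2 ^ d) (2 * d) * B12Decay510Window.K₁ d (τ * θ / 2)) (delta1 (τ * θ) κ d) :=
  decay510_window_414_190 hd B Wn EXn h2n E2n P gn FBn FAn bBn boutn dHn blkn ιn un h190 hC hdist hrow hc hτ hθ
    hστ hκB hN hm₀ hm hD hα₂ hE₀ hκ han h118
    (fun n X => fderiv_eq_zero_of_analytic_invariant hα₂ (han n X) (Ln n) (fun l => h49 n X l) (hspan n))
    hrepr43 hlim

/-- **(5.10) on exhausting windows of ℤᵈ from the residual leaves, `hspan` DISCHARGED to the printed algebraic data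
(v1.1)**: as `decay510_window_ward_190`, but instead of the density hypothesis `hspan` — 𝐠 finite-dimensional and
SEMISIMPLE over ℂ with an ad-invariant nondegenerate bilinear form Φ (*"The group G is semisimple"*; for 𝐠ᶜ the Killing
form), finitely many bonds ιb n per window, a ℂ-linear identification e_n of the window's configuration space with
(ιb n → 𝐠) conjugating the generators L_{n,λ} of the gauge parameters λ (surjecting onto 𝐠: the constant transformations)
to ad_λ, and (4.9) for these generators on the (4.4)-ball ⟹ the same `Decay510` conclusion.
[cite: Balaban1987RG1, (4.3) p.281, (4.7)-(4.14) pp.282-284, (4.35) p.290, (5.10) p.293; Balaban1985Variational, (190) p.308;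
Balaban1984PropagatorsII, Lemma 2.1 (2.61) p.234] -/
theorem decay510_window_lie_190 {d : ℕ} (hd : 0 < d) (B : ℕ → Finset (Pt d)) (Wn : ℕ → Type*)
    [∀ n, NormedAddCommGroup (Wn n)] [∀ n, NormedSpace ℂ (Wn n)]
    (𝔤 : Type*) [LieRing 𝔤] [LieAlgebra ℂ 𝔤] [FiniteDimensional ℂ 𝔤] [LieAlgebra.IsSemisimple ℂ 𝔤]
    (Φ : LinearMap.BilinForm ℂ 𝔤) (hΦinv : Φ.lieInvariant 𝔤) (hΦ : Φ.Nondegenerate)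
    (ιb : ℕ → Type*) [∀ n, Fintype (ιb n)] [∀ n, DecidableEq (ιb n)]
    (en : (n : ℕ) → Wn n ≃ₗ[ℂ] (ιb n → 𝔤)) (Λg : ℕ → Type*) (lamn : (n : ℕ) → Λg n → 𝔤)
    (hlam : ∀ n, Function.Surjective (lamn n)) (Ln : (n : ℕ) → Λg n → (Wn n →L[ℂ] Wn n))
    (hconj : ∀ n l v, en n (Ln n l v) = adConst (K := ℂ) (lamn n l) (en n v))
    (EXn : (n : ℕ) → Dom (B n) → Wn n → ℂ) (h2n : (n : ℕ) → Dom (B n) → Pt d → Pt d → Wn n)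
    (E2n : (n : ℕ) → Dom (B n) → Pt d → Pt d → ℝ) (P : Pt d → ℝ)
    (gn : ℕ → B6.Geometry) (FBn FAn : ℕ → Type) [∀ n, AddCommGroup (FBn n)] [∀ n, Module ℝ (FBn n)]
    [∀ n, AddCommGroup (FAn n)] [∀ n, Module ℝ (FAn n)] (bBn : (n : ℕ) → BlockNorm (gn n) (FBn n))
    (boutn : (n : ℕ) → I → BlockNorm (gn n) (FAn n)) (dHn : (n : ℕ) → FBn n →ₗ[ℝ] FAn n)
    (blkn : (n : ℕ) → Dom (B n) → Finset (gn n).Site) (ιn : (n : ℕ) → Dom (B n) → FAn n → Wn n)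
    (un : (n : ℕ) → Pt d → FBn n) {Cst δ₀ σ τ c m θ κB α₂ E₀ κ : ℝ}
    (h190 : ∀ n i, Ineq190 (bBn n) (boutn n i) (dHn n) Cst δ₀) (hC : 0 ≤ Cst)
    (hdist : ∀ n (a b : (gn n).Site), 0 ≤ (gn n).dist a b) (hrow : ∀ n, RowSum (gn n) σ c) (hc : 0 ≤ c)
    (hτ : 0 < τ) (hθ : 0 < θ) (hστ : σ + τ ≤ δ₀ / 8) (hκB : ∀ n, (bBn n).κ ≤ κB)
    (hN : ∀ n, NormDominated (S := sys (B n)) (boutn n) (blkn n) (V := fun _ => Wn n) (ιn n)) (hm₀ : 0 ≤ m)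
    (hm : ∀ n x y', (bBn n).loc y' (un n x) ≤ m)
    (hD : ∀ n, UnitFieldsLocalised (bBn n) (geom (B n)) (blkn n) (un n) θ)
    (hα₂ : 0 < α₂) (hE₀ : 0 ≤ E₀) (hκ : kappa₀ (4 * 2 ^ d) (2 * d) ≤ κ / 2)
    (han : ∀ n X, AnalyticOnNhd ℂ (EXn n X) (ball 0 α₂))
    (h118 : ∀ n X, ∀ v ∈ ball (0 : Wn n) α₂, ‖EXn n X v‖ ≤ E₀ * Real.exp (-κ * treeLen X.1))
    (h49 : ∀ n X l, ∀ A ∈ ball (0 : Wn n) α₂, fderiv ℂ (EXn n X) A (Ln n l A) = 0)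
    (hrepr43 : ∀ n X x y, E2n n X x y =
      (mixedDeriv (EXn n X) (ιn n X (dHn n (un n x))) (ιn n X (dHn n (un n y)))).re +
        (firstDeriv (EXn n X) (h2n n X x y)).re)
    (hlim : ∀ z, Tendsto (fun n => ∑ X : Dom (B n), E2n n X 0 z) atTop (𝓝 (P z))) :
    B12Sec2to5.Decay510 P (4 * E₀ / α₂ ^ 2 * (Cst * κB * c * m) ^ 2 * Real.exp (delta1 (τ * θ) κ d * d * 2) *
      K₀ (4 * 2 ^ d) (2 * d) * B12Decay510Window.K₁ d (τ * θ / 2)) (delta1 (τ * θ) κ d) :=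
  decay510_window_ward_190 hd B Wn Λg Ln EXn h2n E2n P gn FBn FAn bBn boutn dHn blkn ιn un h190 hC hdist hrow hc
    hτ hθ hστ hκB hN hm₀ hm hD hα₂ hE₀ hκ han h118 h49
    (fun n => dense_span_range_of_conj_adConst Φ hΦinv hΦ (en n) (lamn n) (hlam n) (Ln n) (hconj n))
    hrepr43 hlim

/-- **(5.10) on exhausting windows of ℤᵈ from the residual leaves — algebraic input = *"The group G is semisimple"*
ALONE (v1.2)**: `decay510_window_lie_190` with the invariant nondegenerate form supplied by the Killing form (Cartan's
criterion in characteristic 0, Mathlib `LieAlgebra.HasTrivialRadical.instIsKilling`; cross-read GAPS C-adv2-26, R2):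
hypotheses = 𝐠 finite-dimensional semisimple over ℂ, finitely many bonds per window, a ℂ-linear identification of each
window's configuration space with (bonds → 𝐠) conjugating the generators of the gauge parameters (surjecting onto 𝐠) to
ad_λ, (4.9) for these generators on the (4.4)-ball, and the analytic leaves of `decay510_window_414_190`.
[cite: Balaban1987RG1, (4.3) p.281, (4.7)-(4.14) pp.282-284, (4.35) p.290, (5.10) p.293; Balaban1985Variational, (190) p.308;
Balaban1984PropagatorsII, Lemma 2.1 (2.61) p.234] -/
theorem decay510_window_semisimple_190 {d : ℕ} (hd : 0 < d) (B : ℕ → Finset (Pt d)) (Wn : ℕ → Type*)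
    [∀ n, NormedAddCommGroup (Wn n)] [∀ n, NormedSpace ℂ (Wn n)]
    (𝔤 : Type*) [LieRing 𝔤] [LieAlgebra ℂ 𝔤] [FiniteDimensional ℂ 𝔤] [LieAlgebra.IsSemisimple ℂ 𝔤]
    (ιb : ℕ → Type*) [∀ n, Fintype (ιb n)] [∀ n, DecidableEq (ιb n)]
    (en : (n : ℕ) → Wn n ≃ₗ[ℂ] (ιb n → 𝔤)) (Λg : ℕ → Type*) (lamn : (n : ℕ) → Λg n → 𝔤)
    (hlam : ∀ n, Function.Surjective (lamn n)) (Ln : (n : ℕ) → Λg n → (Wn n →L[ℂ] Wn n))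
    (hconj : ∀ n l v, en n (Ln n l v) = adConst (K := ℂ) (lamn n l) (en n v))
    (EXn : (n : ℕ) → Dom (B n) → Wn n → ℂ) (h2n : (n : ℕ) → Dom (B n) → Pt d → Pt d → Wn n)
    (E2n : (n : ℕ) → Dom (B n) → Pt d → Pt d → ℝ) (P : Pt d → ℝ)
    (gn : ℕ → B6.Geometry) (FBn FAn : ℕ → Type) [∀ n, AddCommGroup (FBn n)] [∀ n, Module ℝ (FBn n)]
    [∀ n, AddCommGroup (FAn n)] [∀ n, Module ℝ (FAn n)] (bBn : (n : ℕ) → BlockNorm (gn n) (FBn n))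
    (boutn : (n : ℕ) → I → BlockNorm (gn n) (FAn n)) (dHn : (n : ℕ) → FBn n →ₗ[ℝ] FAn n)
    (blkn : (n : ℕ) → Dom (B n) → Finset (gn n).Site) (ιn : (n : ℕ) → Dom (B n) → FAn n → Wn n)
    (un : (n : ℕ) → Pt d → FBn n) {Cst δ₀ σ τ c m θ κB α₂ E₀ κ : ℝ}
    (h190 : ∀ n i, Ineq190 (bBn n) (boutn n i) (dHn n) Cst δ₀) (hC : 0 ≤ Cst)
    (hdist : ∀ n (a b : (gn n).Site), 0 ≤ (gn n).dist a b) (hrow : ∀ n, RowSum (gn n) σ c) (hc : 0 ≤ c)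
    (hτ : 0 < τ) (hθ : 0 < θ) (hστ : σ + τ ≤ δ₀ / 8) (hκB : ∀ n, (bBn n).κ ≤ κB)
    (hN : ∀ n, NormDominated (S := sys (B n)) (boutn n) (blkn n) (V := fun _ => Wn n) (ιn n)) (hm₀ : 0 ≤ m)
    (hm : ∀ n x y', (bBn n).loc y' (un n x) ≤ m)
    (hD : ∀ n, UnitFieldsLocalised (bBn n) (geom (B n)) (blkn n) (un n) θ)
    (hα₂ : 0 < α₂) (hE₀ : 0 ≤ E₀) (hκ : kappa₀ (4 * 2 ^ d) (2 * d) ≤ κ / 2)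
    (han : ∀ n X, AnalyticOnNhd ℂ (EXn n X) (ball 0 α₂))
    (h118 : ∀ n X, ∀ v ∈ ball (0 : Wn n) α₂, ‖EXn n X v‖ ≤ E₀ * Real.exp (-κ * treeLen X.1))
    (h49 : ∀ n X l, ∀ A ∈ ball (0 : Wn n) α₂, fderiv ℂ (EXn n X) A (Ln n l A) = 0)
    (hrepr43 : ∀ n X x y, E2n n X x y =
      (mixedDeriv (EXn n X) (ιn n X (dHn n (un n x))) (ιn n X (dHn n (un n y)))).re +
        (firstDeriv (EXn n X) (h2n n X x y)).re)
    (hlim : ∀ z, Tendsto (fun n => ∑ X : Dom (B n), E2n n X 0 z) atTop (𝓝 (P z))) :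
    B12Sec2to5.Decay510 P (4 * E₀ / α₂ ^ 2 * (Cst * κB * c * m) ^ 2 * Real.exp (delta1 (τ * θ) κ d * d * 2) *
      K₀ (4 * 2 ^ d) (2 * d) * B12Decay510Window.K₁ d (τ * θ / 2)) (delta1 (τ * θ) κ d) :=
  decay510_window_lie_190 hd B Wn 𝔤 (killingForm ℂ 𝔤) (LieModule.traceForm_lieInvariant ℂ 𝔤 𝔤)
    (LieAlgebra.IsKilling.killingForm_nondegenerate ℂ 𝔤) ιb en Λg lamn hlam Ln hconj EXn h2n E2n P gn FBn FAn bBn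
    boutn dHn blkn ιn un h190 hC hdist hrow hc hτ hθ hστ hκB hN hm₀ hm hD hα₂ hE₀ hκ han h118 h49 hrepr43 hlim

end Window

/-! ## 4. Capstone, abstract family form (`B12Decay510FromB11.decay510_of_analytic_leaves_190`) -/

section Family

variable {I : Type*}

/-- **(5.10) for an abstract family of finite systems from the residual leaves, (4.14) discharged**: the hypotheses
of `B12Decay510FromB11.decay510_of_analytic_leaves_190` EXCEPT that the two-point function is the FULL n = 2 form of
(4.3) (`hrepr43`) and (4.14) is replaced by (4.9) for linear detecting generators (`h49`, `hspan`) ⟹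
`Decay510 P (4E₀α₂⁻²(Cκ̄_Bcm)² e^{δ₁Mc₁} K₀K₁) δ₁`, δ₁ = ½ min{τθ, κM⁻¹}.
[cite: Balaban1987RG1, (4.3) p.281, (4.7)-(4.14) pp.282-284, (5.10) p.293; Balaban1985Variational, (190) p.308;
Balaban1984PropagatorsII, Lemma 2.1 (2.61) p.234] -/
theorem decay510_of_leaves_ward_190 {d : ℕ} (Sn : ℕ → LocDomainSys) (Cn : (n : ℕ) → B12.CubeCover (Sn n))
    (Λn : ℕ → Type*) (Gn : (n : ℕ) → SiteGeometry (Cn n) (Λn n)) (ρn : (n : ℕ) → Λn n → Λn n → ℝ)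
    (Wn : ℕ → Type*) [∀ n, NormedAddCommGroup (Wn n)] [∀ n, NormedSpace ℂ (Wn n)] (Λg : ℕ → Type*)
    (Ln : (n : ℕ) → Λg n → (Wn n →L[ℂ] Wn n))
    (EXn : (n : ℕ) → (Sn n).Dom → Wn n → ℂ) (h2n : (n : ℕ) → (Sn n).Dom → Λn n → Λn n → Wn n)
    (E2n : (n : ℕ) → (Sn n).Dom → Λn n → Λn n → ℝ)
    (e : (n : ℕ) → (Fin d → ℤ) → Λn n) (P : (Fin d → ℤ) → ℝ)
    (gn : ℕ → B6.Geometry) (FBn FAn : ℕ → Type) [∀ n, AddCommGroup (FBn n)] [∀ n, Module ℝ (FBn n)]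
    [∀ n, AddCommGroup (FAn n)] [∀ n, Module ℝ (FAn n)] (bBn : (n : ℕ) → BlockNorm (gn n) (FBn n))
    (boutn : (n : ℕ) → I → BlockNorm (gn n) (FAn n)) (dHn : (n : ℕ) → FBn n →ₗ[ℝ] FAn n)
    (blkn : (n : ℕ) → (Sn n).Dom → Finset (gn n).Site) (ιn : (n : ℕ) → (Sn n).Dom → FAn n → Wn n)
    (un : (n : ℕ) → Λn n → FBn n) {Cst δ₀ σ τ c m θ κB α₂ E₀ κ M c₁ K₀ K₁ : ℝ}
    (h190 : ∀ n i, Ineq190 (bBn n) (boutn n i) (dHn n) Cst δ₀) (hC : 0 ≤ Cst)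
    (hd : ∀ n (a b : (gn n).Site), 0 ≤ (gn n).dist a b) (hrow : ∀ n, RowSum (gn n) σ c) (hc : 0 ≤ c)
    (hτ : 0 ≤ τ) (hθ : 0 ≤ θ) (hστ : σ + τ ≤ δ₀ / 8) (hκB : ∀ n, (bBn n).κ ≤ κB)
    (hN : ∀ n, NormDominated (boutn n) (blkn n) (V := fun _ => Wn n) (ιn n)) (hm₀ : 0 ≤ m)
    (hm : ∀ n x y', (bBn n).loc y' (un n x) ≤ m) (hD : ∀ n, UnitFieldsLocalised (bBn n) (Gn n) (blkn n) (un n) θ)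
    (hα₂ : 0 < α₂) (hE₀ : 0 ≤ E₀) (hK₀ : 0 ≤ K₀) (hκ : 0 ≤ κ) (hM : 0 < M)
    (han : ∀ n X, AnalyticOnNhd ℂ (EXn n X) (ball 0 α₂))
    (h118 : ∀ n X, ∀ v ∈ ball (0 : Wn n) α₂, ‖EXn n X v‖ ≤ E₀ * Real.exp (-κ * (Sn n).dj X))
    (h49 : ∀ n X l, ∀ A ∈ ball (0 : Wn n) α₂, fderiv ℂ (EXn n X) A (Ln n l A) = 0)
    (hspan : ∀ n, Dense (Submodule.span ℂ (⋃ l, Set.range (Ln n l)) : Set (Wn n)))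
    (hrepr43 : ∀ n X x y, E2n n X x y =
      (mixedDeriv (EXn n X) (ιn n X (dHn n (un n x))) (ιn n X (dHn n (un n y)))).re +
        (firstDeriv (EXn n X) (h2n n X x y)).re)
    (hgeo : ∀ n, GeomLeaf (Gn n) (ρn n) M c₁) (hcube : ∀ n, CubeSumLeaf (Gn n) (τ * θ / 2) K₁)
    (htree : ∀ n, TreeLeaf (Cn n) (κ / 2) K₀)
    (hρ : ∀ z, ∀ᶠ n in atTop, ρn n (e n 0) (e n z) = B12Sec2to5.l1 z)
    (hlim : ∀ z, Tendsto (fun n => ∑ X, E2n n X (e n 0) (e n z)) atTop (𝓝 (P z))) :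
    B12Sec2to5.Decay510 P (4 * E₀ / α₂ ^ 2 * (Cst * κB * c * m) ^ 2 *
      Real.exp (delta1 (τ * θ) κ M * M * c₁) * K₀ * K₁) (delta1 (τ * θ) κ M) :=
  decay510_of_analytic_leaves_190 Sn Cn Λn Gn ρn Wn EXn E2n e P gn FBn FAn bBn boutn dHn blkn ιn un h190 hC hd
    hrow hc hτ hθ hστ hκB hN hm₀ hm hD hα₂ hE₀ hK₀ hκ hM han h118
    (fun n => repr435_of_repr43 (EXn n) (fun X x => ιn n X (dHn n (un n x))) (h2n n) (E2n n) hα₂ (han n)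
      (fun X => fderiv_eq_zero_of_analytic_invariant hα₂ (han n X) (Ln n) (fun l => h49 n X l) (hspan n))
      (hrepr43 n))
    hgeo hcube htree hρ hlim

end Family

end Literature.MathematicalPhysics.QuantumFieldTheory.Balaban1983to89.B12Ward414
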